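import Literature.NumberTheory.LFunctions.ResidueClassLineMeanSquare
import Literature.Analysis.Fourier.GaussianMeanValue
import Literature.Analysis.FunctionSpaces.SaffariVaughanShift
import Mathlib.MeasureTheory.Function.Jacobian
import HarnessLib

/-!
# Mean squares of the remainder `R(u) = ψ(u; Λ_{q,a}) − (u − 1)₊` in `u^{-(2σ'+1)} du`, `σ' = σ₁ + ε`

Topic `Literature/NumberTheory/LFunctions`. Everything in this file is PROVED (theorems only).

Write `R₁(u) = ψ₁(u; Λ_{q,a}) − (u−1)²/2` (`u ≥ 1`) for the integrated remainder, which by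
`Literature.NumberTheory.LFunctions.ResidueRiesz.rieszMean_sub_eq_integral` is
`(1/2π)∫ u^{1+s} F_{q,a}(s) ds/(s(s+1))` on `Re s = σ'`. For `h > 0` the multiplicative average
`R^{(h)}(u) = (R₁(ue^h) − R₁(u))/(u(e^h − 1))` then equals `(1/2π) ∫ u^{s} m_h(s)F_{q,a}(s) ds/(s(s+1))`
(`Ravg_eq_integral`), i.e. `e^{-σ'v} R^{(h)}(e^v)` is `1/2π` times the Fourier integral `Φ_g(v)` of
`g(t) = m_h F_{q,a} k (σ' + it)`, with `|g| ≤ 9|F_{q,a}|/|s|`. The Gaussian mean-value inequality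
(`Literature.Analysis.Fourier.GaussianMeanValue.integral_gaussian_mul_norm_sq_phi_le`) with the window
`e^{-(v − L/2)²/(1+L²)} ≥ e^{-1/4}` on `[0, L]`, `L = log X`, and the substitution `u = e^v` give
`∫_1^X |R^{(h)}(u)|² u^{-2σ'-1} du ≪ ∫ |F_{q,a}(σ'+it)|² dt/|s|² ≪ φ(q)²(log q+1)²/ε`
(`setIntegral_Ravg_sq_le`), uniformly in `h ∈ (0, 1]`; and since `ψ` is monotone,
`|R − R^{(h)}| ≤ (ψ(ue^h) − ψ(u)) + u(e^h − 1)` (`abs_Ravg_sub_Rrem_le`), whose square integral over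
`[1, Y]` is `≪ φ(q)²/Y` for `e^h = 1 + Y^{-4}` (`setIntegral_junk_sq_le`). The same with the extra
multiplier `e^{θs} − 1` (`|·| ≤ 4 min(1, θ|s|)`) treats `R(ue^θ) − R(u)`. Results:

* `setIntegral_Rrem_sq_le` — `∫_1^X R(u)² u^{-(2σ'+1)} du ≤ C φ(q)² (log q + 1)²/ε`;
* `setIntegral_Rrem_mulShift_sq_le` — for `0 < θ ≤ 1`,
  `∫_1^X (R(ue^θ) − R(u))² u^{-(2σ'+1)} du ≤ C φ(q)² ((log q+1)² θ (1 + log(1/θ+1))²/ε + 1/X)`.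

## References

* H. L. Montgomery, R. C. Vaughan, *Multiplicative Number Theory I. Classical Theory*, CUP 2007,
  §5.1 Thm. 5.4, §13.1 (mean values of `ψ − x` under RH-type hypotheses) (`MontgomeryVaughan2007`).
* B. Saffari, R. C. Vaughan, *On the fractional parts of x/n and related sequences II*, Ann. Inst.
  Fourier 27 (1977), 1–30 (mean squares of `ψ` in short intervals) — background only.
-/

noncomputable section

open Complex Set Metric Filter Topology Real MeasureTheory intervalIntegral
open ArithmeticFunction.vonMangoldt DirichletCharacter
open Literature.Analysis.Fourier.GaussianMeanValue
open Literature.Analysis.FunctionSpaces.SaffariVaughan (integrableOn_Icc_of_bound)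

namespace Literature.NumberTheory.LFunctions.ResidueRiesz

variable {q : ℕ} [NeZero q]

/-! ### The remainders `R`, `R₁` and the multiplicative average `R^{(h)}` -/

/-- `R(u) = ψ(u; Λ_{q,a}) − (u − 1)₊`. [folklore] -/
def Rrem (a : ZMod q) (u : ℝ) : ℝ := ClassicalPsiData.psi (Lam a) u - max (u - 1) 0

/-- `R₁(u) = ψ₁(u; Λ_{q,a}) − (u − 1)²/2`. [folklore] -/
def R1 (a : ZMod q) (u : ℝ) : ℝ := ClassicalPsiData.rieszMean (Lam a) u - (u - 1) ^ 2 / 2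

/-- The multiplicative average `R^{(h)}(u) = (R₁(ue^h) − R₁(u))/(u(e^h − 1))`. [folklore] -/
def Ravg (a : ZMod q) (h u : ℝ) : ℝ := (R1 a (u * Real.exp h) - R1 a u) / (u * (Real.exp h - 1))

omit [NeZero q] in
/-- For `u ≥ 1`, `R(u) = ψ(u) − (u − 1)`. [folklore] -/
theorem Rrem_eq (a : ZMod q) {u : ℝ} (hu : 1 ≤ u) : Rrem a u = ClassicalPsiData.psi (Lam a) u - (u - 1) := by
  rw [Rrem, max_eq_left (by linarith)]

omit [NeZero q] in
/-- **`|R^{(h)}(u) − R(u)| ≤ (ψ(ue^h) − ψ(u)) + u(e^h − 1)`** for `u ≥ 1`, `h > 0` (monotonicity of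
`ψ`: `(y − u)ψ(u) ≤ ψ₁(y) − ψ₁(u) ≤ (y − u)ψ(y)`). [folklore] -/
theorem abs_Ravg_sub_Rrem_le (a : ZMod q) {h : ℝ} (hh : 0 < h) {u : ℝ} (hu : 1 ≤ u) :
    |Ravg a h u - Rrem a u| ≤ (ClassicalPsiData.psi (Lam a) (u * Real.exp h) - ClassicalPsiData.psi (Lam a) u) +
      u * (Real.exp h - 1) := by
  have hΛ : ∀ n, 0 ≤ Lam a n := Lam_nonneg a
  set y : ℝ := u * Real.exp h with hy
  have heh : 1 < Real.exp h := by linarith [Real.add_one_lt_exp hh.ne']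
  have hyu : u < y := by rw [hy]; nlinarith
  have hd : 0 < y - u := by linarith
  have hden : u * (Real.exp h - 1) = y - u := by rw [hy]; ring
  have h1 := ClassicalPsiData.sub_mul_psi_le hΛ (by linarith) hyu.le
  have h2 := ClassicalPsiData.rieszMean_sub_le hΛ hyu.le
  -- numerator bounds
  have hnum : R1 a y - R1 a u = (ClassicalPsiData.rieszMean (Lam a) y - ClassicalPsiData.rieszMean (Lam a) u) -
      (y - u) * ((y - 1) + (u - 1)) / 2 := by
    simp only [R1]; ring
  have hRavg : Ravg a h u = (R1 a y - R1 a u) / (y - u) := by rw [Ravg, hden]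
  rw [hRavg, Rrem_eq a hu, abs_le]
  constructor
  · -- lower: `Ravg ≥ ψ(u) − (y − 1)`
    have : (y - u) * (ClassicalPsiData.psi (Lam a) u - (y - 1)) ≤ R1 a y - R1 a u := by
      rw [hnum]; nlinarith
    have hq : ClassicalPsiData.psi (Lam a) u - (y - 1) ≤ (R1 a y - R1 a u) / (y - u) := by
      rw [le_div_iff₀ hd]; linarith
    have hmono := ClassicalPsiData.psi_mono hΛ hyu.le
    rw [hden]; linarith
  · -- upper: `Ravg ≤ ψ(y) − (u − 1)`
    have : R1 a y - R1 a u ≤ (y - u) * (ClassicalPsiData.psi (Lam a) y - (u - 1)) := by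
      rw [hnum]; nlinarith
    have hq : (R1 a y - R1 a u) / (y - u) ≤ ClassicalPsiData.psi (Lam a) y - (u - 1) := by
      rw [div_le_iff₀ hd]; linarith
    rw [hden]; linarith

/-! ### The line-integral representation of `R^{(h)}` -/

/-- The integrand `g_h(t) = m_h(s) F_{q,a}(s) k(s)`, `s = σ' + it`. [folklore] -/
def gfun (a : ZMod q) (σ' h t : ℝ) : ℂ :=
  mh h ((σ' : ℂ) + t * I) * Faux a ((σ' : ℂ) + t * I) * ClassicalPsiData.kernel ((σ' : ℂ) + t * I)

/-- `g_h = (Φ_{e^h} − Φ_1)/(e^h − 1)` in terms of the tree's integrand `Φ_x(s) = x^{1+s}F k`; in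
particular `g_h` is integrable. [folklore] -/
theorem gfun_eq (a : ZMod q) (σ' : ℝ) {h : ℝ} (hh : 0 < h) (t : ℝ) :
    gfun a σ' h t = (ClassicalPsiData.Phi (Faux a) (Real.exp h) ((σ' : ℂ) + t * I) -
      ClassicalPsiData.Phi (Faux a) 1 ((σ' : ℂ) + t * I)) / ((Real.exp h - 1 : ℝ) : ℂ) := by
  have ofReal_exp_cpow : ∀ (h : ℝ) (w : ℂ), ((Real.exp h : ℝ) : ℂ) ^ w = cexp (h * w) := fun h w ↦ by
    rw [Complex.ofReal_exp, Complex.cpow_def_of_ne_zero (Complex.exp_ne_zero _),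
      Complex.log_exp (by rw [Complex.ofReal_im]; linarith [Real.pi_pos])
        (by rw [Complex.ofReal_im]; linarith [Real.pi_pos])]
  have hden : ((Real.exp h - 1 : ℝ) : ℂ) ≠ 0 := by
    have : 0 < Real.exp h - 1 := by linarith [Real.add_one_le_exp h]
    exact_mod_cast this.ne'
  simp only [gfun, mh, ClassicalPsiData.Phi, ofReal_exp_cpow, Complex.ofReal_one, Complex.one_cpow, one_mul]
  field_simp

/-- `g_h` is integrable (`h > 0`, `σ₁ + ε ≤ σ' ≤ 2`). [folklore] -/
theorem integrable_gfun {σ₁ : ℝ} (hσ₁ : 1 / 2 ≤ σ₁) (hZ : ZerosRealPartLE q σ₁) (a : ZMod q)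
    {ε σ' : ℝ} (hε : 0 < ε) (hσ : σ₁ + ε ≤ σ') (hσ2 : σ' ≤ 2) {h : ℝ} (hh : 0 < h) :
    Integrable (gfun a σ' h) := by
  have h1 := integrable_Phi hσ₁ hZ a (Real.exp_pos h) hε hσ hσ2
  have h2 := integrable_Phi hσ₁ hZ a one_pos hε hσ hσ2
  have := (h1.sub h2).div_const (((Real.exp h - 1 : ℝ) : ℂ))
  exact this.congr (ae_of_all _ fun t ↦ (gfun_eq a σ' hh t).symm)

/-- `‖g_h(t)‖ ≤ 9 ‖F_{q,a}(s)‖/‖s‖` for `0 < h ≤ 1`, `0 ≤ σ' ≤ 1`. [folklore] -/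
theorem norm_gfun_le (a : ZMod q) {σ' : ℝ} (hσ0 : 0 < σ') (hσ1 : σ' ≤ 1) {h : ℝ} (hh : 0 < h)
    (hh1 : h ≤ 1) (t : ℝ) :
    ‖gfun a σ' h t‖ ≤ 9 * ‖Faux a ((σ' : ℂ) + t * I)‖ * ‖(σ' : ℂ) + t * I‖⁻¹ := by
  set s : ℂ := (σ' : ℂ) + t * I with hs
  have hsre : s.re = σ' := by simp [hs]
  have hs0 : s ≠ 0 := by intro h0; have := congrArg Complex.re h0; rw [hsre] at this; simp at this; linarith
  have hs1 : s + 1 ≠ 0 := by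
    intro h0; have := congrArg Complex.re h0; simp [hs] at this; linarith
  have hm := norm_mh_le hh hh1 (s := s) (by rw [hsre]; exact hσ0.le) (by rw [hsre]; exact hσ1)
  have hk : ‖ClassicalPsiData.kernel s‖ = ‖s‖⁻¹ * ‖s + 1‖⁻¹ := by
    rw [ClassicalPsiData.kernel, norm_div, norm_one, norm_mul, one_div, mul_inv]
  rw [gfun, ← hs, norm_mul, norm_mul, hk]
  have hspos : 0 < ‖s‖ := norm_pos_iff.2 hs0
  have hs1pos : 0 < ‖s + 1‖ := norm_pos_iff.2 hs1
  calc ‖mh h s‖ * ‖Faux a s‖ * (‖s‖⁻¹ * ‖s + 1‖⁻¹)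
      ≤ (9 * ‖s + 1‖) * ‖Faux a s‖ * (‖s‖⁻¹ * ‖s + 1‖⁻¹) := by gcongr
    _ = 9 * ‖Faux a s‖ * ‖s‖⁻¹ * (‖s + 1‖ * ‖s + 1‖⁻¹) := by ring
    _ = 9 * ‖Faux a s‖ * ‖s‖⁻¹ := by rw [mul_inv_cancel₀ hs1pos.ne', mul_one]

/-- `‖g_h‖²` is integrable and `∫ ‖g_h‖² ≤ 81 ∫ |F_{q,a}|²/|s|²`. [folklore] -/
theorem integral_norm_sq_gfun_le {a : ZMod q} {σ₁ : ℝ} (hσ₁ : 1 / 2 ≤ σ₁) (hZ : ZerosRealPartLE q σ₁)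
    {ε : ℝ} (hε : 0 < ε) (hσ'1 : σ₁ + ε < 1) {h : ℝ} (hh : 0 < h) (hh1 : h ≤ 1) :
    Integrable (fun t ↦ ‖gfun a (σ₁ + ε) h t‖ ^ 2) ∧
    ∫ t, ‖gfun a (σ₁ + ε) h t‖ ^ 2 ≤
      81 * ((Cpkg * q.totient * (Real.log q + 1)) ^ 2 * ((2 * π + 1) / ε) * (12 * SegmentWeights.S₂)) := by
  obtain ⟨hI, hB⟩ := integral_norm_sq_Faux_div_le a hσ₁ hZ hε hσ'1
  have hσ0 : 0 < σ₁ + ε := by linarith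
  have hpt : ∀ t : ℝ, ‖gfun a (σ₁ + ε) h t‖ ^ 2 ≤
      81 * (‖Faux a (((σ₁ + ε : ℝ) : ℂ) + t * I)‖ ^ 2 * (‖((σ₁ + ε : ℝ) : ℂ) + t * I‖ ^ 2)⁻¹) := by
    intro t
    have h1 := norm_gfun_le a hσ0 hσ'1.le hh hh1 t
    have h0 : 0 ≤ ‖gfun a (σ₁ + ε) h t‖ := norm_nonneg _
    calc ‖gfun a (σ₁ + ε) h t‖ ^ 2 ≤ (9 * ‖Faux a (((σ₁ + ε : ℝ) : ℂ) + t * I)‖ *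
          ‖((σ₁ + ε : ℝ) : ℂ) + t * I‖⁻¹) ^ 2 := pow_le_pow_left₀ h0 h1 2
      _ = _ := by ring
  have hmeas : AEStronglyMeasurable (fun t ↦ ‖gfun a (σ₁ + ε) h t‖ ^ 2) volume :=
    ((integrable_gfun hσ₁ hZ a hε le_rfl (by linarith) hh).norm.aestronglyMeasurable).pow 2
  have hInt : Integrable (fun t ↦ ‖gfun a (σ₁ + ε) h t‖ ^ 2) :=
    (hI.const_mul 81).mono' hmeas (ae_of_all _ fun t ↦ by
      rw [Real.norm_of_nonneg (sq_nonneg _)]; exact hpt t)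
  refine ⟨hInt, ?_⟩
  calc ∫ t, ‖gfun a (σ₁ + ε) h t‖ ^ 2
      ≤ ∫ t : ℝ, 81 * (‖Faux a (((σ₁ + ε : ℝ) : ℂ) + t * I)‖ ^ 2 * (‖((σ₁ + ε : ℝ) : ℂ) + t * I‖ ^ 2)⁻¹) :=
        integral_mono hInt (hI.const_mul 81) hpt
    _ = 81 * ∫ t : ℝ, ‖Faux a (((σ₁ + ε : ℝ) : ℂ) + t * I)‖ ^ 2 * (‖((σ₁ + ε : ℝ) : ℂ) + t * I‖ ^ 2)⁻¹ :=
        MeasureTheory.integral_const_mul _ _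
    _ ≤ _ := by gcongr

/-- **The representation.** For `(a, q) = 1`, under `ZerosRealPartLE q σ₁` (`σ₁ ≥ 1/2`), `σ₁ < σ' ≤ 1`,
`h > 0` and `u ≥ 1`: `R^{(h)}(u) = (1/2π) ∫ u^{σ'+it} g_h(t) dt`. [folklore] -/
theorem Ravg_eq_integral {a : ZMod q} (ha : IsUnit a) {σ₁ : ℝ} (hσ₁ : 1 / 2 ≤ σ₁)
    (hZ : ZerosRealPartLE q σ₁) {σ' : ℝ} (hσ' : σ₁ < σ') (hσ'2 : σ' ≤ 2) {h : ℝ} (hh : 0 < h)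
    {u : ℝ} (hu : 1 ≤ u) :
    ((Ravg a h u : ℝ) : ℂ) = (1 / (2 * π) : ℂ) * ∫ t : ℝ, (u : ℂ) ^ ((σ' : ℂ) + t * I) * gfun a σ' h t := by
  have ofReal_exp_cpow : ∀ (h : ℝ) (w : ℂ), ((Real.exp h : ℝ) : ℂ) ^ w = cexp (h * w) := fun h w ↦ by
    rw [Complex.ofReal_exp, Complex.cpow_def_of_ne_zero (Complex.exp_ne_zero _),
      Complex.log_exp (by rw [Complex.ofReal_im]; linarith [Real.pi_pos])
        (by rw [Complex.ofReal_im]; linarith [Real.pi_pos])]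
  have hu0 : 0 < u := by linarith
  have heh : 0 < Real.exp h - 1 := by linarith [Real.add_one_le_exp h]
  have hy : 1 ≤ u * Real.exp h := by nlinarith [Real.add_one_le_exp h]
  have hε : 0 < σ' - σ₁ := by linarith
  have hI1 := integrable_Phi hσ₁ hZ a (by positivity : 0 < u * Real.exp h) hε (by linarith) hσ'2
  have hI2 := integrable_Phi hσ₁ hZ a hu0 hε (by linarith) hσ'2
  have h1 := rieszMean_sub_eq_integral ha hσ₁ hZ hσ' hσ'2 hy
  have h2 := rieszMean_sub_eq_integral ha hσ₁ hZ hσ' hσ'2 hu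
  have hnum : ((R1 a (u * Real.exp h) - R1 a u : ℝ) : ℂ) =
      (1 / (2 * π) : ℂ) * ∫ t : ℝ, (ClassicalPsiData.Phi (Faux a) (u * Real.exp h) ((σ' : ℂ) + t * I) -
        ClassicalPsiData.Phi (Faux a) u ((σ' : ℂ) + t * I)) := by
    rw [integral_sub hI1 hI2, mul_sub, Complex.ofReal_sub]
    simp only [R1] at h1 h2 ⊢
    rw [h1, h2]
  -- pointwise: `Φ_{ue^h}(s) − Φ_u(s) = u(e^h − 1) · u^s g_h(t)`
  have hpt : ∀ t : ℝ, ClassicalPsiData.Phi (Faux a) (u * Real.exp h) ((σ' : ℂ) + t * I) -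
      ClassicalPsiData.Phi (Faux a) u ((σ' : ℂ) + t * I) =
      ((u * (Real.exp h - 1) : ℝ) : ℂ) * ((u : ℂ) ^ ((σ' : ℂ) + t * I) * gfun a σ' h t) := by
    intro t
    set s : ℂ := (σ' : ℂ) + t * I with hs
    have hden : ((Real.exp h - 1 : ℝ) : ℂ) ≠ 0 := by exact_mod_cast heh.ne'
    have hu0' : (u : ℂ) ≠ 0 := by exact_mod_cast hu0.ne'
    have hsplit : ((u * Real.exp h : ℝ) : ℂ) ^ (1 + s) = (u : ℂ) ^ (1 + s) * cexp (h * (1 + s)) := by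
      rw [Complex.ofReal_mul, Complex.mul_cpow_ofReal_nonneg hu0.le (Real.exp_pos h).le, ofReal_exp_cpow]
    have hpow : (u : ℂ) ^ (1 + s) = (u : ℂ) * (u : ℂ) ^ s := by
      rw [Complex.cpow_add _ _ hu0', Complex.cpow_one]
    simp only [ClassicalPsiData.Phi, gfun, mh, ← hs]
    rw [hsplit, hpow]
    field_simp
    push_cast
    ring
  rw [Ravg, Complex.ofReal_div, hnum, integral_congr_ae (ae_of_all _ hpt), MeasureTheory.integral_const_mul]
  have hden' : ((u * (Real.exp h - 1) : ℝ) : ℂ) ≠ 0 := by exact_mod_cast (mul_pos hu0 heh).ne'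
  rw [← mul_assoc, mul_comm ((1 / (2 * π) : ℂ)), mul_assoc, mul_div_cancel_left₀ _ hden']

/-- **`e^{-σ'v} R^{(h)}(e^v) = (1/2π) Φ_{g_h}(v)`** for `v ≥ 0` (`Φ_g` the Fourier integral of
`GaussianMeanValue.lean`). [folklore] -/
theorem Ravg_exp_eq_phi {a : ZMod q} (ha : IsUnit a) {σ₁ : ℝ} (hσ₁ : 1 / 2 ≤ σ₁)
    (hZ : ZerosRealPartLE q σ₁) {σ' : ℝ} (hσ' : σ₁ < σ') (hσ'2 : σ' ≤ 2) {h : ℝ} (hh : 0 < h)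
    {v : ℝ} (hv : 0 ≤ v) :
    ((Real.exp (-(σ' * v)) * Ravg a h (Real.exp v) : ℝ) : ℂ) = (1 / (2 * π) : ℂ) * phi (gfun a σ' h) v := by
  have ofReal_exp_cpow : ∀ (h : ℝ) (w : ℂ), ((Real.exp h : ℝ) : ℂ) ^ w = cexp (h * w) := fun h w ↦ by
    rw [Complex.ofReal_exp, Complex.cpow_def_of_ne_zero (Complex.exp_ne_zero _),
      Complex.log_exp (by rw [Complex.ofReal_im]; linarith [Real.pi_pos])
        (by rw [Complex.ofReal_im]; linarith [Real.pi_pos])]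
  have hu : 1 ≤ Real.exp v := by simpa using Real.one_le_exp_iff.2 hv |>.trans_eq' rfl
  have h1 := Ravg_eq_integral ha hσ₁ hZ hσ' hσ'2 hh (u := Real.exp v) (Real.one_le_exp_iff.2 hv)
  have hpt : ∀ t : ℝ, ((Real.exp v : ℝ) : ℂ) ^ ((σ' : ℂ) + t * I) * gfun a σ' h t =
      ((Real.exp (σ' * v) : ℝ) : ℂ) * (gfun a σ' h t * cexp (I * t * v)) := by
    intro t
    rw [ofReal_exp_cpow, show (v : ℂ) * ((σ' : ℂ) + t * I) = ((σ' * v : ℝ) : ℂ) + I * t * v by push_cast; ring,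
      Complex.exp_add, Complex.ofReal_exp]
    ring
  rw [Complex.ofReal_mul, h1, integral_congr_ae (ae_of_all _ hpt), MeasureTheory.integral_const_mul, phi]
  have hexp : ((Real.exp (-(σ' * v)) : ℝ) : ℂ) * ((Real.exp (σ' * v) : ℝ) : ℂ) = 1 := by
    rw [← Complex.ofReal_mul, ← Real.exp_add]; simp
  calc ((Real.exp (-(σ' * v)) : ℝ) : ℂ) * ((1 / (2 * π) : ℂ) * (((Real.exp (σ' * v) : ℝ) : ℂ) *
        ∫ t : ℝ, gfun a σ' h t * cexp (I * t * v)))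
      = (((Real.exp (-(σ' * v)) : ℝ) : ℂ) * ((Real.exp (σ' * v) : ℝ) : ℂ)) *
          ((1 / (2 * π) : ℂ) * ∫ t : ℝ, gfun a σ' h t * cexp (I * t * v)) := by ring
    _ = _ := by rw [hexp, one_mul]

/-! ### The Gaussian window on `[0, L]` and the mean square of `R^{(h)}` -/

/-- The bound `B₁ = 81 · 12 S₂ (C φ (log q+1))² (2π+1)/ε` for `∫ ‖g_h‖²`. [folklore] -/
def B₁ (q : ℕ) (ε : ℝ) : ℝ :=
  81 * ((Cpkg * q.totient * (Real.log q + 1)) ^ 2 * ((2 * π + 1) / ε) * (12 * SegmentWeights.S₂))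

omit [NeZero q] in
/-- `B₁ ≥ 0` for `ε > 0`. [folklore] -/
theorem B₁_nonneg (q : ℕ) {ε : ℝ} (hε : 0 < ε) : 0 ≤ B₁ q ε := by
  have := SegmentWeights.S₂_nonneg
  unfold B₁; positivity

/-- **Mean square of `e^{-σ'v}R^{(h)}(e^v)` on `[0, L]`.** For `(a,q) = 1`, under
`ZerosRealPartLE q σ₁` (`σ₁ ≥ 1/2`), `0 < ε`, `σ₁ + ε < 1`, `0 < h ≤ 1`, `L ≥ 0`:
`∫_{[0,L]} (e^{-σ'v} R^{(h)}(e^v))² dv ≤ e^{1/4} B₁/(2π)` (Gaussian mean value with the window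
`e^{-(v-L/2)²/(1+L²)} ≥ e^{-1/4}` on `[0, L]`). [folklore] -/
theorem setIntegral_Ravg_exp_sq_le {a : ZMod q} (ha : IsUnit a) {σ₁ : ℝ} (hσ₁ : 1 / 2 ≤ σ₁)
    (hZ : ZerosRealPartLE q σ₁) {ε : ℝ} (hε : 0 < ε) (hσ'1 : σ₁ + ε < 1) {h : ℝ} (hh : 0 < h)
    (hh1 : h ≤ 1) (L : ℝ) :
    IntegrableOn (fun v : ℝ ↦ (Real.exp (-((σ₁ + ε) * v)) * Ravg a h (Real.exp v)) ^ 2) (Icc 0 L) ∧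
    ∫ v in Icc 0 L, (Real.exp (-((σ₁ + ε) * v)) * Ravg a h (Real.exp v)) ^ 2 ≤
      Real.exp (1 / 4) / (2 * π) * B₁ q ε := by
  set σ' : ℝ := σ₁ + ε with hσ'
  have hσ'σ₁ : σ₁ < σ' := by rw [hσ']; linarith
  set g : ℝ → ℂ := gfun a σ' h with hgdef
  have hg : Integrable g := integrable_gfun hσ₁ hZ a hε le_rfl (by linarith) hh
  obtain ⟨hg2, hg2le⟩ := integral_norm_sq_gfun_le (a := a) hσ₁ hZ hε hσ'1 hh hh1
  set b : ℝ := 1 / (1 + L ^ 2) with hb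
  have hb0 : 0 < b := by positivity
  set c : ℝ := L / 2 with hc
  have hGMV := integral_gaussian_mul_norm_sq_phi_le hg hg2 hb0 c
  have hWint := integrable_gaussian_mul_norm_sq_phi hg hb0 c
  -- the identity on `[0, L]`
  have heq : ∀ v ∈ Icc 0 L, (Real.exp (-(σ' * v)) * Ravg a h (Real.exp v)) ^ 2 =
      (1 / (2 * π)) ^ 2 * ‖phi g v‖ ^ 2 := by
    intro v hv
    have h1 := Ravg_exp_eq_phi ha hσ₁ hZ hσ'σ₁ (by linarith) hh hv.1
    have h2 : |Real.exp (-(σ' * v)) * Ravg a h (Real.exp v)| = ‖(1 / (2 * π) : ℂ) * phi g v‖ := by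
      rw [← Real.norm_eq_abs, ← Complex.norm_real, h1]
    rw [← sq_abs, h2, norm_mul, mul_pow]
    congr 1
    rw [show (1 / (2 * π) : ℂ) = ((1 / (2 * π) : ℝ) : ℂ) by push_cast; ring, Complex.norm_real,
      Real.norm_of_nonneg (by positivity)]
  -- the window is `≥ e^{-1/4}` on `[0, L]`
  have hwin : ∀ v ∈ Icc 0 L, (1 : ℝ) ≤ Real.exp (1 / 4) * Real.exp (-b * (v - c) ^ 2) := by
    intro v hv
    rw [← Real.exp_add]
    have h1 : (v - c) ^ 2 ≤ (L / 2) ^ 2 :=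
      sq_le_sq' (by rw [hc]; linarith [hv.1, hv.2]) (by rw [hc]; linarith [hv.1, hv.2])
    have h2 : b * (v - c) ^ 2 ≤ 1 / 4 := by
      calc b * (v - c) ^ 2 ≤ b * (L / 2) ^ 2 := mul_le_mul_of_nonneg_left h1 hb0.le
        _ = L ^ 2 / (4 * (1 + L ^ 2)) := by rw [hb]; field_simp; ring
        _ ≤ 1 / 4 := by rw [div_le_div_iff₀ (by positivity) (by norm_num)]; nlinarith
    linarith [Real.add_one_le_exp (1 / 4 + -b * (v - c) ^ 2)]
  have hcontφ : Continuous fun v : ℝ ↦ (1 / (2 * π)) ^ 2 * ‖phi g v‖ ^ 2 :=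
    continuous_const.mul ((continuous_phi hg).norm.pow 2)
  have hIon : IntegrableOn (fun v : ℝ ↦ (Real.exp (-(σ' * v)) * Ravg a h (Real.exp v)) ^ 2) (Icc 0 L) :=
    (hcontφ.integrableOn_Icc).congr_fun (fun v hv ↦ (heq v hv).symm) measurableSet_Icc
  refine ⟨hIon, ?_⟩
  set Wφ : ℝ → ℝ := fun v ↦ Real.exp (-b * (v - c) ^ 2) * ‖phi g v‖ ^ 2 with hWφ
  have hB : ∫ t, ‖g t‖ ^ 2 ≤ B₁ q ε := by rw [B₁]; exact hg2le
  calc ∫ v in Icc 0 L, (Real.exp (-(σ' * v)) * Ravg a h (Real.exp v)) ^ 2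
      = ∫ v in Icc 0 L, (1 / (2 * π)) ^ 2 * ‖phi g v‖ ^ 2 := setIntegral_congr_fun measurableSet_Icc heq
    _ ≤ ∫ v in Icc 0 L, Real.exp (1 / 4) * (1 / (2 * π)) ^ 2 * Wφ v := by
        refine setIntegral_mono_on hcontφ.integrableOn_Icc ((hWint.const_mul _).integrableOn)
          measurableSet_Icc fun v hv ↦ ?_
        have h0 : 0 ≤ (1 / (2 * π)) ^ 2 * ‖phi g v‖ ^ 2 := by positivity
        calc (1 / (2 * π)) ^ 2 * ‖phi g v‖ ^ 2 = 1 * ((1 / (2 * π)) ^ 2 * ‖phi g v‖ ^ 2) := (one_mul _).symm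
          _ ≤ (Real.exp (1 / 4) * Real.exp (-b * (v - c) ^ 2)) * ((1 / (2 * π)) ^ 2 * ‖phi g v‖ ^ 2) :=
              mul_le_mul_of_nonneg_right (hwin v hv) h0
          _ = Real.exp (1 / 4) * (1 / (2 * π)) ^ 2 * Wφ v := by rw [hWφ]; ring
    _ ≤ ∫ v, Real.exp (1 / 4) * (1 / (2 * π)) ^ 2 * Wφ v :=
        setIntegral_le_integral (hWint.const_mul _) (ae_of_all _ fun v ↦ by positivity)
    _ = Real.exp (1 / 4) * (1 / (2 * π)) ^ 2 * ∫ v, Wφ v := MeasureTheory.integral_const_mul _ _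
    _ ≤ Real.exp (1 / 4) * (1 / (2 * π)) ^ 2 * ((2 * π) * ∫ t, ‖g t‖ ^ 2) := by gcongr
    _ ≤ Real.exp (1 / 4) * (1 / (2 * π)) ^ 2 * ((2 * π) * B₁ q ε) := by gcongr
    _ = Real.exp (1 / 4) / (2 * π) * B₁ q ε := by field_simp

/-! ### The substitution `u = e^v` -/

omit [NeZero q] in
/-- `exp([0, L]) = [1, e^L]`. [folklore] -/
theorem exp_image_Icc (L : ℝ) : Real.exp '' Icc 0 L = Icc 1 (Real.exp L) := by
  ext y
  constructor
  · rintro ⟨x, hx, rfl⟩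
    exact ⟨by simpa using Real.exp_le_exp.2 hx.1, Real.exp_le_exp.2 hx.2⟩
  · intro hy
    have hy0 : 0 < y := by linarith [hy.1]
    refine ⟨Real.log y, ⟨Real.log_nonneg hy.1, (Real.log_le_iff_le_exp hy0).2 hy.2⟩, Real.exp_log hy0⟩

omit [NeZero q] in
/-- `∫_{[1, e^L]} f(u) du = ∫_{[0, L]} e^v f(e^v) dv`. [folklore] -/
theorem setIntegral_Icc_one_exp (f : ℝ → ℝ) (L : ℝ) :
    ∫ u in Icc 1 (Real.exp L), f u = ∫ v in Icc 0 L, Real.exp v * f (Real.exp v) := by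
  rw [← exp_image_Icc L, integral_image_eq_integral_abs_deriv_smul measurableSet_Icc
    (fun x _ ↦ (Real.hasDerivAt_exp x).hasDerivWithinAt) Real.exp_injective.injOn]
  refine setIntegral_congr_fun measurableSet_Icc fun v _ ↦ ?_
  rw [abs_of_pos (Real.exp_pos v), smul_eq_mul]

/-- **Mean square of `R^{(h)}` against `u^{-(2σ'+1)} du` on `[1, X]`.** For `(a,q) = 1`, under
`ZerosRealPartLE q σ₁` (`σ₁ ≥ 1/2`), `0 < ε`, `σ₁ + ε < 1`, `0 < h ≤ 1`, `X ≥ 1`: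
`∫_1^X R^{(h)}(u)² u^{-(2σ'+1)} du ≤ e^{1/4} B₁/(2π)`. [folklore] -/
theorem setIntegral_Ravg_sq_rpow_le {a : ZMod q} (ha : IsUnit a) {σ₁ : ℝ} (hσ₁ : 1 / 2 ≤ σ₁)
    (hZ : ZerosRealPartLE q σ₁) {ε : ℝ} (hε : 0 < ε) (hσ'1 : σ₁ + ε < 1) {h : ℝ} (hh : 0 < h)
    (hh1 : h ≤ 1) {X : ℝ} (hX : 1 ≤ X) :
    ∫ u in Icc 1 X, Ravg a h u ^ 2 * u ^ (-(2 * (σ₁ + ε) + 1)) ≤ Real.exp (1 / 4) / (2 * π) * B₁ q ε := by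
  set σ' : ℝ := σ₁ + ε with hσ'
  set L : ℝ := Real.log X with hLdef
  have hXL : Real.exp L = X := Real.exp_log (by linarith)
  rw [← hXL, setIntegral_Icc_one_exp _ L]
  have heq : ∀ v ∈ Icc 0 L, Real.exp v * (Ravg a h (Real.exp v) ^ 2 * Real.exp v ^ (-(2 * σ' + 1))) =
      (Real.exp (-(σ' * v)) * Ravg a h (Real.exp v)) ^ 2 := by
    intro v _
    have h1 : Real.exp v * Real.exp v ^ (-(2 * σ' + 1)) = Real.exp (-(σ' * v)) ^ 2 := by
      rw [← Real.exp_mul, ← Real.exp_add, pow_two, ← Real.exp_add]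
      congr 1; ring
    calc Real.exp v * (Ravg a h (Real.exp v) ^ 2 * Real.exp v ^ (-(2 * σ' + 1)))
        = Ravg a h (Real.exp v) ^ 2 * (Real.exp v * Real.exp v ^ (-(2 * σ' + 1))) := by ring
      _ = _ := by rw [h1]; ring
  rw [setIntegral_congr_fun measurableSet_Icc heq]
  exact (setIntegral_Ravg_exp_sq_le ha hσ₁ hZ hε hσ'1 hh hh1 L).2

/-! ### Measurability -/

omit [NeZero q] in
/-- `ψ(·; Λ_{q,a})` is measurable (monotone). [folklore] -/
theorem measurable_psi (a : ZMod q) : Measurable (ClassicalPsiData.psi (Lam a)) :=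
  (ClassicalPsiData.psi_mono (Lam_nonneg a)).measurable

omit [NeZero q] in
/-- `ψ₁(·; Λ_{q,a})` is monotone. [folklore] -/
theorem rieszMean_mono (a : ZMod q) : Monotone (ClassicalPsiData.rieszMean (Lam a)) := by
  intro x y hxy
  rcases le_or_gt 0 y with hy | hy
  · have h1 := ClassicalPsiData.sub_mul_psi_le (Lam_nonneg a) hy hxy
    have h0 := ClassicalPsiData.psi_nonneg (Lam_nonneg a) x
    nlinarith
  · have hx : x < 0 := lt_of_le_of_lt hxy hy
    simp [ClassicalPsiData.rieszMean, Nat.floor_of_nonpos hx.le, Nat.floor_of_nonpos hy.le]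

omit [NeZero q] in
/-- `R₁` is measurable. [folklore] -/
theorem measurable_R1 (a : ZMod q) : Measurable (R1 a) :=
  (rieszMean_mono a).measurable.sub (by fun_prop)

omit [NeZero q] in
/-- `R` is measurable. [folklore] -/
theorem measurable_Rrem (a : ZMod q) : Measurable (Rrem a) :=
  (measurable_psi a).sub ((measurable_id.sub_const 1).max measurable_const)

omit [NeZero q] in
/-- `R^{(h)}` is measurable. [folklore] -/
theorem measurable_Ravg (a : ZMod q) (h : ℝ) : Measurable (Ravg a h) :=
  (((measurable_R1 a).comp (measurable_id.mul_const _)).sub (measurable_R1 a)).div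
    (measurable_id.mul_const _)

omit [NeZero q] in
/-- Crude bounds: `0 ≤ ψ(u) ≤ ψ(Z)` and `|R(u)| ≤ ψ(Z) + Z` for `1 ≤ u ≤ Z`. [folklore] -/
theorem abs_Rrem_le (a : ZMod q) {u Z : ℝ} (hu : 1 ≤ u) (huZ : u ≤ Z) :
    |Rrem a u| ≤ ClassicalPsiData.psi (Lam a) Z + Z := by
  rw [Rrem_eq a hu, abs_le]
  have h0 := ClassicalPsiData.psi_nonneg (Lam_nonneg a) u
  have h1 := ClassicalPsiData.psi_mono (Lam_nonneg a) huZ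
  constructor <;> linarith

/-! ### The junk term `R − R^{(h)}` for `e^h = 1 + Y^{-4}` -/

/-- `h_Y = log(1 + Y^{-4})`, so that `e^{h_Y} − 1 = Y^{-4}`. [folklore] -/
def hY (Y : ℝ) : ℝ := Real.log (1 + (Y ^ 4)⁻¹)

omit [NeZero q] in
/-- `e^{h_Y} = 1 + Y^{-4}`. [folklore] -/
theorem exp_hY {Y : ℝ} (hY0 : 0 < Y) : Real.exp (hY Y) = 1 + (Y ^ 4)⁻¹ :=
  Real.exp_log (by positivity)

omit [NeZero q] in
/-- `0 < h_Y`. [folklore] -/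
theorem hY_pos {Y : ℝ} (hY0 : 0 < Y) : 0 < hY Y := by
  have h4 : (0 : ℝ) < (Y ^ 4)⁻¹ := by positivity
  exact Real.log_pos (by linarith)

omit [NeZero q] in
/-- `h_Y ≤ Y^{-4} ≤ 1` for `Y ≥ 1`. [folklore] -/
theorem hY_le {Y : ℝ} (hY1 : 1 ≤ Y) : hY Y ≤ (Y ^ 4)⁻¹ ∧ (Y ^ 4)⁻¹ ≤ 1 := by
  constructor
  · have := Real.log_le_sub_one_of_pos (show (0 : ℝ) < 1 + (Y ^ 4)⁻¹ by positivity)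
    rw [hY]; linarith
  · rw [inv_le_comm₀ (by positivity) one_pos, inv_one]; exact one_le_pow₀ hY1

omit [NeZero q] in
/-- **At most one integer in `(u, ue^{h_Y}]`**: for `1 ≤ u ≤ Y`,
`ψ(ue^{h_Y}) − ψ(u) ≤ Λ_{q,a}(⌊u⌋ + 1)`, and if the difference is non-zero then
`(⌊u⌋ + 1)e^{-h_Y} ≤ u`. [folklore] -/
theorem psi_sub_psi_le (a : ZMod q) {Y u : ℝ} (hY1 : 1 ≤ Y) (hu1 : 1 ≤ u) (huY : u ≤ Y) :
    ClassicalPsiData.psi (Lam a) (u * Real.exp (hY Y)) - ClassicalPsiData.psi (Lam a) u ≤ Lam a (⌊u⌋₊ + 1) ∧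
    (ClassicalPsiData.psi (Lam a) (u * Real.exp (hY Y)) - ClassicalPsiData.psi (Lam a) u ≠ 0 →
      ((⌊u⌋₊ + 1 : ℕ) : ℝ) * Real.exp (-hY Y) ≤ u) := by
  have hY0 : 0 < Y := by linarith
  have hu0 : 0 ≤ u := by linarith
  set y : ℝ := u * Real.exp (hY Y) with hydef
  have hy : y = u + u * (Y ^ 4)⁻¹ := by rw [hydef, exp_hY hY0]; ring
  have hY4 : Y ≤ Y ^ 4 := by nlinarith [one_le_pow₀ (n := 3) hY1]
  have huy : u ≤ y := by rw [hy]; nlinarith [inv_nonneg.2 (pow_nonneg hY0.le 4)]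
  have hy1 : y ≤ u + 1 := by
    rw [hy]
    have : u * (Y ^ 4)⁻¹ ≤ 1 := by
      rw [← div_eq_mul_inv, div_le_one (by positivity)]; linarith
    linarith
  set m : ℕ := ⌊u⌋₊ with hm
  have hfl : ⌊y⌋₊ ≤ m + 1 := by
    calc ⌊y⌋₊ ≤ ⌊u + 1⌋₊ := Nat.floor_le_floor hy1
      _ = m + 1 := by rw [hm, Nat.floor_add_one hu0]
  have hml : m ≤ ⌊y⌋₊ := Nat.floor_le_floor huy
  have hdiff : ClassicalPsiData.psi (Lam a) y - ClassicalPsiData.psi (Lam a) u =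
      ∑ n ∈ Finset.Ioc m ⌊y⌋₊, Lam a n := by
    simp only [ClassicalPsiData.psi]
    rw [← Finset.sum_Ioc_consecutive _ (Nat.zero_le m) hml, ← hm]
    ring
  have hsub : Finset.Ioc m ⌊y⌋₊ ⊆ {m + 1} := by
    rw [← Nat.Ioc_succ_singleton]
    exact Finset.Ioc_subset_Ioc_right hfl
  constructor
  · rw [hdiff]
    calc ∑ n ∈ Finset.Ioc m ⌊y⌋₊, Lam a n ≤ ∑ n ∈ ({m + 1} : Finset ℕ), Lam a n :=
          Finset.sum_le_sum_of_subset_of_nonneg hsub fun n _ _ ↦ Lam_nonneg a n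
      _ = Lam a (m + 1) := Finset.sum_singleton _ _
  · intro hne
    rw [hdiff] at hne
    have hnonempty : (Finset.Ioc m ⌊y⌋₊).Nonempty := by
      by_contra hcon
      rw [Finset.not_nonempty_iff_eq_empty] at hcon
      rw [hcon, Finset.sum_empty] at hne
      exact hne rfl
    obtain ⟨n, hn⟩ := hnonempty
    rw [Finset.mem_Ioc] at hn
    have h1 : m + 1 ≤ ⌊y⌋₊ := by omega
    have h2 : ((m + 1 : ℕ) : ℝ) ≤ y := by
      have := Nat.floor_le (show 0 ≤ y by linarith)
      calc ((m + 1 : ℕ) : ℝ) ≤ (⌊y⌋₊ : ℝ) := by exact_mod_cast h1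
        _ ≤ y := this
    calc ((m + 1 : ℕ) : ℝ) * Real.exp (-hY Y) ≤ y * Real.exp (-hY Y) := by gcongr
      _ = u := by rw [hydef, mul_assoc, ← Real.exp_add]; simp

/-- The junk bound `J(u) = (ψ(ue^{h_Y}) − ψ(u)) + u(e^{h_Y} − 1)`. [folklore] -/
def junk (a : ZMod q) (Y u : ℝ) : ℝ :=
  (ClassicalPsiData.psi (Lam a) (u * Real.exp (hY Y)) - ClassicalPsiData.psi (Lam a) u) + u * (Real.exp (hY Y) - 1)

omit [NeZero q] in
/-- `|R^{(h_Y)}(u) − R(u)| ≤ J(u)` for `u ≥ 1`. [folklore] -/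
theorem abs_Ravg_sub_Rrem_le_junk (a : ZMod q) {Y u : ℝ} (hY0 : 0 < Y) (hu : 1 ≤ u) :
    |Ravg a (hY Y) u - Rrem a u| ≤ junk a Y u :=
  abs_Ravg_sub_Rrem_le a (hY_pos hY0) hu

/-- **`∫_{[1,Y]} J(u)² du ≤ 66 φ(q)²/Y`** for `Y ≥ 1`. [folklore] -/
theorem setIntegral_junk_sq_le (a : ZMod q) {Y : ℝ} (hY1 : 1 ≤ Y) :
    IntegrableOn (fun u ↦ junk a Y u ^ 2) (Icc 1 Y) ∧
    ∫ u in Icc 1 Y, junk a Y u ^ 2 ≤ 66 * (q.totient : ℝ) ^ 2 / Y := by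
  have hY0 : 0 < Y := by linarith
  have hφ1 : (1 : ℝ) ≤ q.totient := by exact_mod_cast Nat.totient_pos.2 (NeZero.pos q)
  set h : ℝ := hY Y with hh
  obtain ⟨hhle, hY4le⟩ := hY_le hY1
  have hh0 : 0 < h := hY_pos hY0
  have heh : Real.exp h - 1 = (Y ^ 4)⁻¹ := by rw [hh, exp_hY hY0]; ring
  set N : ℕ := ⌊Y⌋₊ + 1 with hN
  have hNY : (N : ℝ) ≤ 2 * Y := by
    rw [hN]; push_cast; linarith [Nat.floor_le hY0.le]
  set S : Set ℝ := ⋃ n ∈ Finset.Icc 1 N, Ico ((n : ℝ) * Real.exp (-h)) n with hS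
  have hSm : MeasurableSet S := Finset.measurableSet_biUnion _ fun n _ ↦ measurableSet_Ico
  set Lg : ℝ := (q.totient : ℝ) * Real.log (Y + 1) with hLg
  have hLg0 : 0 ≤ Lg := mul_nonneg (Nat.cast_nonneg _) (Real.log_nonneg (by linarith))
  -- pointwise bound of the first part of `J`
  have hA : ∀ u ∈ Icc 1 Y, ClassicalPsiData.psi (Lam a) (u * Real.exp h) - ClassicalPsiData.psi (Lam a) u ≤
      Lg * S.indicator 1 u ∧ 0 ≤ ClassicalPsiData.psi (Lam a) (u * Real.exp h) - ClassicalPsiData.psi (Lam a) u := by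
    intro u hu
    obtain ⟨h1, h2⟩ := psi_sub_psi_le a hY1 hu.1 hu.2
    have hmono : 0 ≤ ClassicalPsiData.psi (Lam a) (u * Real.exp h) - ClassicalPsiData.psi (Lam a) u := by
      have : u ≤ u * Real.exp h := by nlinarith [Real.add_one_le_exp h, hu.1]
      linarith [ClassicalPsiData.psi_mono (Lam_nonneg a) this]
    refine ⟨?_, hmono⟩
    rcases eq_or_ne (ClassicalPsiData.psi (Lam a) (u * Real.exp h) - ClassicalPsiData.psi (Lam a) u) 0 with h0 | h0
    · rw [h0]; exact mul_nonneg hLg0 (Set.indicator_nonneg (fun _ _ ↦ zero_le_one) u)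
    · have hmem : u ∈ S := by
        rw [hS]
        simp only [Set.mem_iUnion, Set.mem_Ico, Finset.mem_Icc, exists_prop]
        refine ⟨⌊u⌋₊ + 1, ⟨by omega, ?_⟩, h2 h0, ?_⟩
        · rw [hN]; exact Nat.succ_le_succ (Nat.floor_le_floor hu.2)
        · push_cast; exact Nat.lt_floor_add_one u
      rw [Set.indicator_of_mem hmem, Pi.one_apply, mul_one]
      refine h1.trans ?_
      calc Lam a (⌊u⌋₊ + 1) ≤ q.totient * ArithmeticFunction.vonMangoldt (⌊u⌋₊ + 1) := Lam_le a _
        _ ≤ q.totient * Real.log ((⌊u⌋₊ + 1 : ℕ) : ℝ) :=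
            mul_le_mul_of_nonneg_left ArithmeticFunction.vonMangoldt_le_log (Nat.cast_nonneg _)
        _ ≤ q.totient * Real.log (Y + 1) := by
            gcongr
            push_cast; linarith [Nat.floor_le (show 0 ≤ u by linarith [hu.1]), hu.2]
  -- pointwise bound of `J²`
  have hJ : ∀ u ∈ Icc 1 Y, junk a Y u ^ 2 ≤ 2 * Lg ^ 2 * S.indicator 1 u + 2 * (Y ^ 3)⁻¹ ^ 2 := by
    intro u hu
    obtain ⟨h1, h0⟩ := hA u hu
    have hind : S.indicator (1 : ℝ → ℝ) u ^ 2 = S.indicator 1 u := by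
      by_cases hm : u ∈ S <;> simp [hm]
    have h2 : u * (Real.exp h - 1) ≤ (Y ^ 3)⁻¹ := by
      rw [heh]
      calc u * (Y ^ 4)⁻¹ ≤ Y * (Y ^ 4)⁻¹ := by gcongr; exact hu.2
        _ = (Y ^ 3)⁻¹ := by field_simp
    have h3 : 0 ≤ u * (Real.exp h - 1) := by
      rw [heh]; exact mul_nonneg (by linarith [hu.1]) (by positivity)
    have hj : junk a Y u ≤ Lg * S.indicator 1 u + (Y ^ 3)⁻¹ := by
      simp only [junk, ← hh]; linarith
    have hj0 : 0 ≤ junk a Y u := by simp only [junk, ← hh]; linarith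
    calc junk a Y u ^ 2 ≤ (Lg * S.indicator 1 u + (Y ^ 3)⁻¹) ^ 2 := pow_le_pow_left₀ hj0 hj 2
      _ ≤ 2 * (Lg * S.indicator 1 u) ^ 2 + 2 * (Y ^ 3)⁻¹ ^ 2 := by
          nlinarith [sq_nonneg (Lg * S.indicator 1 u - (Y ^ 3)⁻¹)]
      _ = 2 * Lg ^ 2 * S.indicator 1 u + 2 * (Y ^ 3)⁻¹ ^ 2 := by rw [mul_pow, hind]; ring
  -- integrability
  have hJm : Measurable fun u ↦ junk a Y u ^ 2 := by
    refine Measurable.pow_const ?_ 2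
    exact (((measurable_psi a).comp (measurable_id.mul_const _)).sub (measurable_psi a)).add
      (measurable_id.mul_const _)
  have hbound : ∀ u ∈ Icc 1 Y, |junk a Y u ^ 2| ≤ 2 * Lg ^ 2 + 2 * (Y ^ 3)⁻¹ ^ 2 := by
    intro u hu
    rw [abs_of_nonneg (sq_nonneg _)]
    refine (hJ u hu).trans ?_
    have : S.indicator (1 : ℝ → ℝ) u ≤ 1 := Set.indicator_le_self' (fun _ _ ↦ zero_le_one) u |>.trans (le_refl _)
    nlinarith [sq_nonneg Lg]
  have hInt : IntegrableOn (fun u ↦ junk a Y u ^ 2) (Icc 1 Y) := integrableOn_Icc_of_bound hJm hbound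
  refine ⟨hInt, ?_⟩
  -- measure of `S`
  have hSvol : volume.real S ≤ 4 / Y ^ 2 := by
    have h1 : volume.real S ≤ ∑ n ∈ Finset.Icc 1 N, volume.real (Ico ((n : ℝ) * Real.exp (-h)) (n : ℝ)) := by
      rw [hS]; exact measureReal_biUnion_finset_le _ _
    have h2 : ∀ n ∈ Finset.Icc 1 N, volume.real (Ico ((n : ℝ) * Real.exp (-h)) (n : ℝ)) ≤ (N : ℝ) * h := by
      intro n hn
      rw [Finset.mem_Icc] at hn
      have hn0 : (0 : ℝ) ≤ n := Nat.cast_nonneg n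
      have hnN : (n : ℝ) ≤ N := by exact_mod_cast hn.2
      have hexp : 1 - h ≤ Real.exp (-h) := by linarith [Real.add_one_le_exp (-h)]
      have hle : (n : ℝ) - (n : ℝ) * Real.exp (-h) ≤ (N : ℝ) * h := by nlinarith
      rw [Measure.real, Real.volume_Ico]
      rcases le_or_gt 0 ((n : ℝ) - (n : ℝ) * Real.exp (-h)) with hc | hc
      · rw [ENNReal.toReal_ofReal hc]; exact hle
      · rw [ENNReal.ofReal_of_nonpos hc.le, ENNReal.toReal_zero]; positivity
    calc volume.real S ≤ ∑ n ∈ Finset.Icc 1 N, volume.real (Ico ((n : ℝ) * Real.exp (-h)) (n : ℝ)) := h1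
      _ ≤ ∑ n ∈ Finset.Icc 1 N, (N : ℝ) * h := Finset.sum_le_sum h2
      _ = (N : ℝ) * ((N : ℝ) * h) := by simp
      _ ≤ (2 * Y) * ((2 * Y) * (Y ^ 4)⁻¹) := by
          have hN0 : (0 : ℝ) ≤ N := Nat.cast_nonneg N
          have : (N : ℝ) * h ≤ (2 * Y) * (Y ^ 4)⁻¹ := by gcongr
          nlinarith [mul_nonneg hN0 hh0.le]
      _ = 4 / Y ^ 2 := by field_simp; ring
  -- integrate
  have hmeas1 : Measurable (S.indicator (1 : ℝ → ℝ)) := measurable_one.indicator hSm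
  have hRm : Measurable fun u ↦ 2 * Lg ^ 2 * S.indicator (1 : ℝ → ℝ) u + 2 * (Y ^ 3)⁻¹ ^ 2 :=
    (hmeas1.const_mul _).add measurable_const
  have hind1 : ∀ u, S.indicator (1 : ℝ → ℝ) u ≤ 1 := fun u ↦ by
    by_cases hm : u ∈ S <;> simp [hm]
  have hind0 : ∀ u, 0 ≤ S.indicator (1 : ℝ → ℝ) u := fun u ↦ by
    by_cases hm : u ∈ S <;> simp [hm]
  have hRI : IntegrableOn (fun u ↦ 2 * Lg ^ 2 * S.indicator (1 : ℝ → ℝ) u + 2 * (Y ^ 3)⁻¹ ^ 2) (Icc 1 Y) := by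
    refine integrableOn_Icc_of_bound hRm (M := 2 * Lg ^ 2 + 2 * (Y ^ 3)⁻¹ ^ 2) fun u _ ↦ ?_
    rw [abs_of_nonneg (by have := hind0 u; positivity)]
    nlinarith [hind1 u, sq_nonneg Lg]
  have hSfin : volume S ≠ ⊤ := by
    rw [hS]
    refine ((measure_biUnion_finset_le _ _).trans_lt (ENNReal.sum_lt_top.2 fun n _ ↦ ?_)).ne
    rw [Real.volume_Ico]; exact ENNReal.ofReal_lt_top
  have hIind : IntegrableOn (S.indicator (1 : ℝ → ℝ)) (Icc 1 Y) :=
    integrableOn_Icc_of_bound hmeas1 (M := 1) fun u _ ↦ abs_le.2 ⟨by linarith [hind0 u], hind1 u⟩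
  have hvolIcc : volume.real (Icc 1 Y) = Y - 1 := by
    rw [Measure.real, Real.volume_Icc, ENNReal.toReal_ofReal (by linarith)]
  have hstep : ∫ u in Icc 1 Y, (2 * Lg ^ 2 * S.indicator (1 : ℝ → ℝ) u + 2 * (Y ^ 3)⁻¹ ^ 2) ≤
      2 * Lg ^ 2 * (4 / Y ^ 2) + 2 * (Y ^ 3)⁻¹ ^ 2 * Y := by
    rw [integral_add (hIind.const_mul _) (integrableOn_const (hs := measure_Icc_lt_top.ne)),
      MeasureTheory.integral_const_mul, setIntegral_indicator hSm, setIntegral_const]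
    simp only [Pi.one_apply]
    rw [setIntegral_const, smul_eq_mul, smul_eq_mul, mul_one, hvolIcc]
    have h1 : volume.real (Icc 1 Y ∩ S) ≤ 4 / Y ^ 2 :=
      (measureReal_mono Set.inter_subset_right hSfin).trans hSvol
    have h2 : (0 : ℝ) ≤ 2 * (Y ^ 3)⁻¹ ^ 2 := by positivity
    nlinarith [sq_nonneg Lg, h1]
  have hlog : Real.log (Y + 1) ^ 2 ≤ 8 * Y := by
    have h1 := Real.log_le_rpow_div (show (0 : ℝ) ≤ Y + 1 by linarith) (show (0 : ℝ) < 1 / 2 by norm_num)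
    have h0 : 0 ≤ Real.log (Y + 1) := Real.log_nonneg (by linarith)
    have h2 : ((Y + 1) ^ (1 / 2 : ℝ)) ^ 2 = Y + 1 := by
      rw [← Real.rpow_two, ← Real.rpow_mul (by linarith)]; norm_num
    calc Real.log (Y + 1) ^ 2 ≤ ((Y + 1) ^ (1 / 2 : ℝ) / (1 / 2)) ^ 2 := pow_le_pow_left₀ h0 h1 2
      _ = 4 * (Y + 1) := by rw [div_pow, h2]; norm_num; ring
      _ ≤ 8 * Y := by linarith
  calc ∫ u in Icc 1 Y, junk a Y u ^ 2
      ≤ ∫ u in Icc 1 Y, (2 * Lg ^ 2 * S.indicator (1 : ℝ → ℝ) u + 2 * (Y ^ 3)⁻¹ ^ 2) :=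
        setIntegral_mono_on hInt hRI measurableSet_Icc hJ
    _ ≤ 2 * Lg ^ 2 * (4 / Y ^ 2) + 2 * (Y ^ 3)⁻¹ ^ 2 * Y := hstep
    _ = (8 * ((q.totient : ℝ) ^ 2 * Real.log (Y + 1) ^ 2) * Y ^ 3 + 2) / Y ^ 5 := by
        rw [hLg]; field_simp; ring
    _ ≤ (8 * ((q.totient : ℝ) ^ 2 * (8 * Y)) * Y ^ 3 + 2 * ((q.totient : ℝ) ^ 2 * Y ^ 4)) / Y ^ 5 := by
        gcongr
        · nlinarith [one_le_pow₀ (n := 4) hY1, hφ1]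
    _ = 66 * (q.totient : ℝ) ^ 2 / Y := by field_simp; ring

/-! ### The mean square of `R` -/

/-- The absolute constant of `setIntegral_Rrem_sq_le`. [folklore] -/
def CE1 : ℝ := 81 * 12 * SegmentWeights.S₂ * Cpkg ^ 2 * (2 * π + 1) * (Real.exp (1 / 4) / π) + 132

/-- The weight `u^{-(2σ'+1)}` lies in `[0, 1]` on `u ≥ 1` (`σ' ≥ 0`). [folklore] -/
theorem rpow_weight_mem {σ' u : ℝ} (hσ' : 0 ≤ σ') (hu : 1 ≤ u) :
    0 ≤ u ^ (-(2 * σ' + 1)) ∧ u ^ (-(2 * σ' + 1)) ≤ 1 :=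
  ⟨Real.rpow_nonneg (by linarith) _, Real.rpow_le_one_of_one_le_of_nonpos hu (by linarith)⟩

/-- **Mean square of `R`.** For `(a, q) = 1`, under `ZerosRealPartLE q σ₁` (`σ₁ ≥ 1/2`), `0 < ε`,
`σ₁ + ε < 1` and `X ≥ 1`:
`∫_1^X R(u)² u^{-(2σ'+1)} du ≤ C_{E1} φ(q)² (log q + 1)²/ε`, `σ' = σ₁ + ε`, with the absolute
constant `C_{E1}`. [cite: MontgomeryVaughan2007, §13.1 (method)] -/
theorem setIntegral_Rrem_sq_le {a : ZMod q} (ha : IsUnit a) {σ₁ : ℝ} (hσ₁ : 1 / 2 ≤ σ₁)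
    (hZ : ZerosRealPartLE q σ₁) {ε : ℝ} (hε : 0 < ε) (hσ'1 : σ₁ + ε < 1) {X : ℝ} (hX : 1 ≤ X) :
    IntegrableOn (fun u ↦ Rrem a u ^ 2 * u ^ (-(2 * (σ₁ + ε) + 1))) (Icc 1 X) ∧
    ∫ u in Icc 1 X, Rrem a u ^ 2 * u ^ (-(2 * (σ₁ + ε) + 1)) ≤
      CE1 * (q.totient : ℝ) ^ 2 * (Real.log q + 1) ^ 2 / ε := by
  set σ' : ℝ := σ₁ + ε with hσ'
  have hσ'0 : 0 ≤ σ' := by rw [hσ']; linarith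
  have hX0 : 0 < X := by linarith
  have hφ1 : (1 : ℝ) ≤ q.totient := by exact_mod_cast Nat.totient_pos.2 (NeZero.pos q)
  set h : ℝ := hY X with hhdef
  obtain ⟨hhle, hX4le⟩ := hY_le hX
  have hh0 : 0 < h := hY_pos hX0
  have hh1 : h ≤ 1 := hhle.trans hX4le
  have heh2 : Real.exp h ≤ 2 := by rw [hhdef, exp_hY hX0]; linarith
  set w : ℝ → ℝ := fun u ↦ u ^ (-(2 * σ' + 1)) with hw
  have hwm : Measurable w := Measurable.pow_const measurable_id _
  set P : ℝ := ClassicalPsiData.psi (Lam a) (2 * X) with hP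
  have hP0 : 0 ≤ P := ClassicalPsiData.psi_nonneg (Lam_nonneg a) _
  -- crude bounds on `[1, X]`
  have hbR : ∀ u ∈ Icc 1 X, |Rrem a u| ≤ P + X := by
    intro u hu
    refine (abs_Rrem_le a hu.1 hu.2).trans ?_
    have := ClassicalPsiData.psi_mono (Lam_nonneg a) (show X ≤ 2 * X by linarith)
    linarith
  have hbJ : ∀ u ∈ Icc 1 X, 0 ≤ junk a X u ∧ junk a X u ≤ P + 1 := by
    intro u hu
    have hu0 : 0 ≤ u := by linarith [hu.1]
    have h1 : u ≤ u * Real.exp h := by nlinarith [Real.add_one_le_exp h]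
    have h2 : u * Real.exp h ≤ 2 * X := by nlinarith [hu.2]
    have m1 := ClassicalPsiData.psi_mono (Lam_nonneg a) h1
    have m2 := ClassicalPsiData.psi_mono (Lam_nonneg a) h2
    have m3 := ClassicalPsiData.psi_nonneg (Lam_nonneg a) u
    have h3 : 0 ≤ u * (Real.exp h - 1) := mul_nonneg hu0 (by linarith [Real.add_one_le_exp h])
    have h4 : u * (Real.exp h - 1) ≤ 1 := by
      rw [hhdef, exp_hY hX0]
      calc u * (1 + (X ^ 4)⁻¹ - 1) = u * (X ^ 4)⁻¹ := by ring
        _ ≤ X * (X ^ 4)⁻¹ := by gcongr; exact hu.2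
        _ = (X ^ 3)⁻¹ := by field_simp
        _ ≤ 1 := by rw [inv_le_comm₀ (by positivity) one_pos, inv_one]; exact one_le_pow₀ hX
    simp only [junk, ← hhdef]
    constructor <;> linarith
  have hbA : ∀ u ∈ Icc 1 X, |Ravg a h u| ≤ 2 * P + X + 1 := by
    intro u hu
    have h1 := abs_Ravg_sub_Rrem_le_junk a hX0 hu.1
    rw [← hhdef] at h1
    have h2 := hbR u hu
    obtain ⟨-, h3⟩ := hbJ u hu
    have := abs_sub_abs_le_abs_sub (Ravg a h u) (Rrem a u)
    linarith
  -- integrability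
  have hIL : IntegrableOn (fun u ↦ Rrem a u ^ 2 * w u) (Icc 1 X) := by
    refine integrableOn_Icc_of_bound (((measurable_Rrem a).pow_const 2).mul hwm) (M := (P + X) ^ 2)
      fun u hu ↦ ?_
    obtain ⟨hw0, hw1⟩ := rpow_weight_mem hσ'0 hu.1
    show |Rrem a u ^ 2 * w u| ≤ (P + X) ^ 2
    rw [abs_of_nonneg (mul_nonneg (sq_nonneg _) hw0)]
    have := (sq_abs (Rrem a u)).symm.le.trans (pow_le_pow_left₀ (abs_nonneg _) (hbR u hu) 2)
    nlinarith [sq_nonneg (Rrem a u)]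
  have hIA : IntegrableOn (fun u ↦ Ravg a h u ^ 2 * w u) (Icc 1 X) := by
    refine integrableOn_Icc_of_bound (((measurable_Ravg a h).pow_const 2).mul hwm) (M := (2 * P + X + 1) ^ 2)
      fun u hu ↦ ?_
    obtain ⟨hw0, hw1⟩ := rpow_weight_mem hσ'0 hu.1
    show |Ravg a h u ^ 2 * w u| ≤ (2 * P + X + 1) ^ 2
    rw [abs_of_nonneg (mul_nonneg (sq_nonneg _) hw0)]
    have := (sq_abs (Ravg a h u)).symm.le.trans (pow_le_pow_left₀ (abs_nonneg _) (hbA u hu) 2)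
    nlinarith [sq_nonneg (Ravg a h u)]
  obtain ⟨hIJ, hJle⟩ := setIntegral_junk_sq_le a hX
  refine ⟨hIL, ?_⟩
  -- pointwise
  have hpt : ∀ u ∈ Icc 1 X, Rrem a u ^ 2 * w u ≤ 2 * (Ravg a h u ^ 2 * w u) + 2 * junk a X u ^ 2 := by
    intro u hu
    obtain ⟨hw0, hw1⟩ := rpow_weight_mem hσ'0 hu.1
    have h1 := abs_Ravg_sub_Rrem_le_junk a hX0 hu.1
    rw [← hhdef] at h1
    have h2 : Rrem a u ^ 2 ≤ 2 * Ravg a h u ^ 2 + 2 * junk a X u ^ 2 := by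
      have := sq_abs (Ravg a h u - Rrem a u)
      have h3 := pow_le_pow_left₀ (abs_nonneg _) h1 2
      nlinarith [sq_nonneg (Ravg a h u + (Ravg a h u - Rrem a u))]
    calc Rrem a u ^ 2 * w u ≤ (2 * Ravg a h u ^ 2 + 2 * junk a X u ^ 2) * w u :=
          mul_le_mul_of_nonneg_right h2 hw0
      _ = 2 * (Ravg a h u ^ 2 * w u) + 2 * junk a X u ^ 2 * w u := by ring
      _ ≤ 2 * (Ravg a h u ^ 2 * w u) + 2 * junk a X u ^ 2 * 1 := by gcongr
      _ = _ := by ring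
  have hmain : ∫ u in Icc 1 X, Ravg a h u ^ 2 * w u ≤ Real.exp (1 / 4) / (2 * π) * B₁ q ε :=
    setIntegral_Ravg_sq_rpow_le ha hσ₁ hZ hε hσ'1 hh0 hh1 hX
  have hIR : IntegrableOn (fun u ↦ 2 * (Ravg a h u ^ 2 * w u) + 2 * junk a X u ^ 2) (Icc 1 X) :=
    (hIA.const_mul 2).add (hIJ.const_mul 2)
  calc ∫ u in Icc 1 X, Rrem a u ^ 2 * w u
      ≤ ∫ u in Icc 1 X, (2 * (Ravg a h u ^ 2 * w u) + 2 * junk a X u ^ 2) :=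
        setIntegral_mono_on hIL hIR measurableSet_Icc hpt
    _ = 2 * (∫ u in Icc 1 X, Ravg a h u ^ 2 * w u) + 2 * ∫ u in Icc 1 X, junk a X u ^ 2 := by
        rw [integral_add (hIA.const_mul 2) (hIJ.const_mul 2), MeasureTheory.integral_const_mul,
          MeasureTheory.integral_const_mul]
    _ ≤ 2 * (Real.exp (1 / 4) / (2 * π) * B₁ q ε) + 2 * (66 * (q.totient : ℝ) ^ 2 / X) :=
        add_le_add (mul_le_mul_of_nonneg_left hmain zero_le_two) (mul_le_mul_of_nonneg_left hJle zero_le_two)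
    _ ≤ CE1 * (q.totient : ℝ) ^ 2 * (Real.log q + 1) ^ 2 / ε := by
        have hlog : (1 : ℝ) ≤ (Real.log q + 1) ^ 2 := by
          have := Real.log_natCast_nonneg q; nlinarith
        have hε1 : ε ≤ 1 := by linarith
        have hS := SegmentWeights.S₂_nonneg
        have hC := Cpkg_pos
        have e1 : 2 * (Real.exp (1 / 4) / (2 * π) * B₁ q ε) =
            (81 * 12 * SegmentWeights.S₂ * Cpkg ^ 2 * (2 * π + 1) * (Real.exp (1 / 4) / π)) *
              (q.totient : ℝ) ^ 2 * (Real.log q + 1) ^ 2 / ε := by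
          simp only [B₁]; field_simp
        have e2 : 2 * (66 * (q.totient : ℝ) ^ 2 / X) ≤ 132 * (q.totient : ℝ) ^ 2 * (Real.log q + 1) ^ 2 / ε := by
          rw [show 2 * (66 * (q.totient : ℝ) ^ 2 / X) = (132 * (q.totient : ℝ) ^ 2) / X by ring,
            div_le_div_iff₀ hX0 hε]
          have hφ2 : 0 ≤ (q.totient : ℝ) ^ 2 := sq_nonneg _
          have h1 : (q.totient : ℝ) ^ 2 * ε ≤ (q.totient : ℝ) ^ 2 * ((Real.log q + 1) ^ 2 * X) := by
            refine mul_le_mul_of_nonneg_left ?_ hφ2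
            nlinarith
          nlinarith
        rw [e1, CE1]
        have e3 : (81 * 12 * SegmentWeights.S₂ * Cpkg ^ 2 * (2 * π + 1) * (Real.exp (1 / 4) / π) + 132) *
            (q.totient : ℝ) ^ 2 * (Real.log q + 1) ^ 2 / ε =
            (81 * 12 * SegmentWeights.S₂ * Cpkg ^ 2 * (2 * π + 1) * (Real.exp (1 / 4) / π)) *
              (q.totient : ℝ) ^ 2 * (Real.log q + 1) ^ 2 / ε +
            132 * (q.totient : ℝ) ^ 2 * (Real.log q + 1) ^ 2 / ε := by ring
        rw [e3]
        linarith

/-! ### The mean square of the multiplicative difference `R(ue^θ) − R(u)` -/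

/-- The integrand with the shift multiplier: `g_{h,θ}(t) = (e^{θs} − 1) g_h(t)`. [folklore] -/
def gsfun (a : ZMod q) (σ' h θ t : ℝ) : ℂ := (cexp (θ * ((σ' : ℂ) + t * I)) - 1) * gfun a σ' h t

/-- `‖e^{θs} − 1‖ ≤ 4` for `0 < θ ≤ 1`, `Re s ≤ 1`. [folklore] -/
theorem norm_cexp_sub_one_le_four {θ : ℝ} (hθ : 0 < θ) (hθ1 : θ ≤ 1) {s : ℂ} (hs1 : s.re ≤ 1) :
    ‖cexp (θ * s) - 1‖ ≤ 4 := by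
  have := norm_cexp_sub_one_le_min hθ hθ1 hs1
  linarith [min_le_left (1 : ℝ) (θ * ‖s‖)]

/-- `g_{h,θ}` is integrable. [folklore] -/
theorem integrable_gsfun {σ₁ : ℝ} (hσ₁ : 1 / 2 ≤ σ₁) (hZ : ZerosRealPartLE q σ₁) (a : ZMod q)
    {ε σ' : ℝ} (hε : 0 < ε) (hσ : σ₁ + ε ≤ σ') (hσ1 : σ' ≤ 1) {h : ℝ} (hh : 0 < h) {θ : ℝ}
    (hθ : 0 < θ) (hθ1 : θ ≤ 1) : Integrable (gsfun a σ' h θ) := by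
  have hg := integrable_gfun hσ₁ hZ a hε hσ (by linarith) hh
  refine (hg.norm.const_mul 4).mono' ?_ (ae_of_all _ fun t ↦ ?_)
  · exact (Continuous.aestronglyMeasurable (by fun_prop)).mul hg.aestronglyMeasurable
  · rw [gsfun, norm_mul]
    have := norm_cexp_sub_one_le_four hθ hθ1 (s := (σ' : ℂ) + t * I) (by simp; exact hσ1)
    have h0 := norm_nonneg (gfun a σ' h t)
    nlinarith

/-- `‖g_{h,θ}(t)‖² ≤ 1296 |F_{q,a}(s)|² min(1/|s|², θ²)`. [folklore] -/
theorem norm_sq_gsfun_le (a : ZMod q) {σ' : ℝ} (hσ0 : 0 < σ') (hσ1 : σ' ≤ 1) {h : ℝ} (hh : 0 < h)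
    (hh1 : h ≤ 1) {θ : ℝ} (hθ : 0 < θ) (hθ1 : θ ≤ 1) (t : ℝ) :
    ‖gsfun a σ' h θ t‖ ^ 2 ≤ 1296 * (‖Faux a ((σ' : ℂ) + t * I)‖ ^ 2 *
      min ((‖(σ' : ℂ) + t * I‖ ^ 2)⁻¹) (θ ^ 2)) := by
  set s : ℂ := (σ' : ℂ) + t * I with hs
  have hsre : s.re = σ' := by simp [hs]
  have hs0 : s ≠ 0 := by intro h0; have := congrArg Complex.re h0; rw [hsre] at this; simp at this; linarith
  have hspos : 0 < ‖s‖ := norm_pos_iff.2 hs0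
  have h1 := norm_gfun_le a hσ0 hσ1 hh hh1 t
  rw [← hs] at h1
  have h2 := norm_cexp_sub_one_le_min hθ hθ1 (s := s) (by rw [hsre]; exact hσ1)
  have hF0 := norm_nonneg (Faux a s)
  have hg0 := norm_nonneg (gfun a σ' h t)
  rw [gsfun, ← hs, norm_mul]
  rcases le_or_gt (θ * ‖s‖) 1 with hc | hc
  · rw [min_eq_right hc] at h2
    have hmin : min ((‖s‖ ^ 2)⁻¹) (θ ^ 2) = θ ^ 2 := by
      refine min_eq_right ?_
      rw [le_inv_comm₀ (by positivity) (by positivity), ← one_div, le_div_iff₀ (by positivity)]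
      nlinarith [mul_nonneg hθ.le hspos.le]
    rw [hmin]
    have hprod : ‖cexp (θ * s) - 1‖ * ‖gfun a σ' h t‖ ≤ (4 * (θ * ‖s‖)) * (9 * ‖Faux a s‖ * ‖s‖⁻¹) :=
      mul_le_mul h2 h1 hg0 (by positivity)
    have heq : (4 * (θ * ‖s‖)) * (9 * ‖Faux a s‖ * ‖s‖⁻¹) = 36 * θ * ‖Faux a s‖ := by
      field_simp
      ring
    rw [heq] at hprod
    have h0 : 0 ≤ ‖cexp (θ * s) - 1‖ * ‖gfun a σ' h t‖ := by positivity
    calc (‖cexp (θ * s) - 1‖ * ‖gfun a σ' h t‖) ^ 2 ≤ (36 * θ * ‖Faux a s‖) ^ 2 :=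
          pow_le_pow_left₀ h0 hprod 2
      _ = 1296 * (‖Faux a s‖ ^ 2 * θ ^ 2) := by ring
  · rw [min_eq_left hc.le] at h2
    have hmin : min ((‖s‖ ^ 2)⁻¹) (θ ^ 2) = (‖s‖ ^ 2)⁻¹ := by
      refine min_eq_left ?_
      rw [inv_le_comm₀ (by positivity) (by positivity), ← one_div, div_le_iff₀ (by positivity)]
      nlinarith [mul_nonneg hθ.le hspos.le]
    rw [hmin]
    have hprod : ‖cexp (θ * s) - 1‖ * ‖gfun a σ' h t‖ ≤ (4 * 1) * (9 * ‖Faux a s‖ * ‖s‖⁻¹) :=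
      mul_le_mul h2 h1 hg0 (by positivity)
    have h0 : 0 ≤ ‖cexp (θ * s) - 1‖ * ‖gfun a σ' h t‖ := by positivity
    calc (‖cexp (θ * s) - 1‖ * ‖gfun a σ' h t‖) ^ 2 ≤ ((4 * 1) * (9 * ‖Faux a s‖ * ‖s‖⁻¹)) ^ 2 :=
          pow_le_pow_left₀ h0 hprod 2
      _ = 1296 * (‖Faux a s‖ ^ 2 * (‖s‖ ^ 2)⁻¹) := by ring

/-- The bound `B₂(θ) = 1296 · 10⁶ θ (1 + log(1/θ+1))² (C φ (log q+1))² (2π+1)/ε` for `∫ ‖g_{h,θ}‖²`.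
[folklore] -/
def B₂ (q : ℕ) (ε θ : ℝ) : ℝ :=
  1296 * ((Cpkg * q.totient * (Real.log q + 1)) ^ 2 * ((2 * π + 1) / ε) *
    (1000000 * θ * (1 + Real.log (1 / θ + 1)) ^ 2))

/-- `‖g_{h,θ}‖²` is integrable and `∫ ‖g_{h,θ}‖² ≤ B₂(θ)`. [folklore] -/
theorem integral_norm_sq_gsfun_le {a : ZMod q} {σ₁ : ℝ} (hσ₁ : 1 / 2 ≤ σ₁) (hZ : ZerosRealPartLE q σ₁)
    {ε : ℝ} (hε : 0 < ε) (hσ'1 : σ₁ + ε < 1) {h : ℝ} (hh : 0 < h) (hh1 : h ≤ 1) {θ : ℝ}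
    (hθ : 0 < θ) (hθ1 : θ ≤ 1) :
    Integrable (fun t ↦ ‖gsfun a (σ₁ + ε) h θ t‖ ^ 2) ∧
    ∫ t, ‖gsfun a (σ₁ + ε) h θ t‖ ^ 2 ≤ B₂ q ε θ := by
  obtain ⟨hI, hB⟩ := integral_norm_sq_Faux_min_le a hσ₁ hZ hε hσ'1 hθ hθ1
  have hσ0 : 0 < σ₁ + ε := by linarith
  have hpt : ∀ t : ℝ, ‖gsfun a (σ₁ + ε) h θ t‖ ^ 2 ≤
      1296 * (‖Faux a (((σ₁ + ε : ℝ) : ℂ) + t * I)‖ ^ 2 *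
        min ((‖((σ₁ + ε : ℝ) : ℂ) + t * I‖ ^ 2)⁻¹) (θ ^ 2)) :=
    fun t ↦ norm_sq_gsfun_le a hσ0 hσ'1.le hh hh1 hθ hθ1 t
  have hmeas : AEStronglyMeasurable (fun t ↦ ‖gsfun a (σ₁ + ε) h θ t‖ ^ 2) volume :=
    ((integrable_gsfun hσ₁ hZ a hε le_rfl hσ'1.le hh hθ hθ1).norm.aestronglyMeasurable).pow 2
  have hInt : Integrable (fun t ↦ ‖gsfun a (σ₁ + ε) h θ t‖ ^ 2) :=
    (hI.const_mul 1296).mono' hmeas (ae_of_all _ fun t ↦ by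
      rw [Real.norm_of_nonneg (sq_nonneg _)]; exact hpt t)
  refine ⟨hInt, ?_⟩
  calc ∫ t, ‖gsfun a (σ₁ + ε) h θ t‖ ^ 2
      ≤ ∫ t : ℝ, 1296 * (‖Faux a (((σ₁ + ε : ℝ) : ℂ) + t * I)‖ ^ 2 *
          min ((‖((σ₁ + ε : ℝ) : ℂ) + t * I‖ ^ 2)⁻¹) (θ ^ 2)) := integral_mono hInt (hI.const_mul 1296) hpt
    _ = 1296 * ∫ t : ℝ, ‖Faux a (((σ₁ + ε : ℝ) : ℂ) + t * I)‖ ^ 2 *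
          min ((‖((σ₁ + ε : ℝ) : ℂ) + t * I‖ ^ 2)⁻¹) (θ ^ 2) := MeasureTheory.integral_const_mul _ _
    _ ≤ B₂ q ε θ := by rw [B₂]; gcongr

/-- The multiplicative difference of the averages, `G^{(h)}_θ(u) = R^{(h)}(ue^θ) − R^{(h)}(u)`. [folklore] -/
def Gavg (a : ZMod q) (h θ u : ℝ) : ℝ := Ravg a h (u * Real.exp θ) - Ravg a h u

omit [NeZero q] in
/-- `G^{(h)}_θ` is measurable. [folklore] -/
theorem measurable_Gavg (a : ZMod q) (h θ : ℝ) : Measurable (Gavg a h θ) :=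
  ((measurable_Ravg a h).comp (measurable_id.mul_const _)).sub (measurable_Ravg a h)

omit [NeZero q] in
/-- `t ↦ g(t) e^{itv}` is integrable for `g ∈ L¹`. [folklore] -/
theorem integrable_mul_cexp {g : ℝ → ℂ} (hg : Integrable g) (v : ℝ) :
    Integrable fun t : ℝ ↦ g t * cexp (I * t * v) := by
  refine hg.norm.mono' (hg.aestronglyMeasurable.mul (Continuous.aestronglyMeasurable (by fun_prop)))
    (ae_of_all _ fun t ↦ ?_)
  rw [norm_mul, norm_cexp_I_mul_mul, mul_one]

/-- `Φ_{g_{h,θ}}(v) = e^{σ'θ} Φ_{g_h}(v + θ) − Φ_{g_h}(v)`. [folklore] -/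
theorem phi_gsfun {σ₁ : ℝ} (hσ₁ : 1 / 2 ≤ σ₁) (hZ : ZerosRealPartLE q σ₁) (a : ZMod q)
    {ε σ' : ℝ} (hε : 0 < ε) (hσ : σ₁ + ε ≤ σ') (hσ2 : σ' ≤ 2) {h : ℝ} (hh : 0 < h) (θ v : ℝ) :
    phi (gsfun a σ' h θ) v = ((Real.exp (σ' * θ) : ℝ) : ℂ) * phi (gfun a σ' h) (v + θ) - phi (gfun a σ' h) v := by
  have hg := integrable_gfun hσ₁ hZ a hε hσ hσ2 hh
  have h1 := integrable_mul_cexp hg (v + θ)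
  have h2 := integrable_mul_cexp hg v
  have hpt : ∀ t : ℝ, gsfun a σ' h θ t * cexp (I * t * v) =
      ((Real.exp (σ' * θ) : ℝ) : ℂ) * (gfun a σ' h t * cexp (I * t * ((v + θ : ℝ) : ℂ))) -
        gfun a σ' h t * cexp (I * t * v) := by
    intro t
    simp only [gsfun, Complex.ofReal_exp]
    push_cast
    rw [show (θ : ℂ) * ((σ' : ℂ) + (t : ℂ) * I) = (σ' : ℂ) * θ + I * t * θ by ring, Complex.exp_add,
      show I * (t : ℂ) * ((v : ℂ) + θ) = I * t * v + I * t * θ by ring, Complex.exp_add]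
    ring
  simp only [phi]
  rw [integral_congr_ae (ae_of_all _ hpt), integral_sub (h1.const_mul _) h2, MeasureTheory.integral_const_mul]

/-- **`e^{-σ'v} G^{(h)}_θ(e^v) = (1/2π) Φ_{g_{h,θ}}(v)`** for `v ≥ 0`, `θ ≥ 0`. [folklore] -/
theorem Gavg_exp_eq_phi {a : ZMod q} (ha : IsUnit a) {σ₁ : ℝ} (hσ₁ : 1 / 2 ≤ σ₁)
    (hZ : ZerosRealPartLE q σ₁) {ε σ' : ℝ} (hε : 0 < ε) (hσ : σ₁ + ε ≤ σ') (hσ'2 : σ' ≤ 2) {h : ℝ}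
    (hh : 0 < h) {θ : ℝ} (hθ : 0 ≤ θ) {v : ℝ} (hv : 0 ≤ v) :
    ((Real.exp (-(σ' * v)) * Gavg a h θ (Real.exp v) : ℝ) : ℂ) =
      (1 / (2 * π) : ℂ) * phi (gsfun a σ' h θ) v := by
  have hσ' : σ₁ < σ' := by linarith
  have h1 := Ravg_exp_eq_phi ha hσ₁ hZ hσ' hσ'2 hh hv
  have h2 := Ravg_exp_eq_phi ha hσ₁ hZ hσ' hσ'2 hh (v := v + θ) (by linarith)
  rw [phi_gsfun hσ₁ hZ a hε hσ hσ'2 hh θ v, mul_sub, ← h1]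
  have hexp : Real.exp v * Real.exp θ = Real.exp (v + θ) := by rw [← Real.exp_add]
  have h3 : Real.exp (-(σ' * v)) * Ravg a h (Real.exp v * Real.exp θ) =
      Real.exp (σ' * θ) * (Real.exp (-(σ' * (v + θ))) * Ravg a h (Real.exp (v + θ))) := by
    rw [hexp, ← mul_assoc, ← Real.exp_add]
    congr 1; congr 1; ring
  rw [Gavg, mul_sub, Complex.ofReal_sub, h3, Complex.ofReal_mul, h2]
  ring

/-- **Mean square of `e^{-σ'v}G^{(h)}_θ(e^v)` on `[0, L]`**: `≤ e^{1/4} B₂(θ)/(2π)`. [folklore] -/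
theorem setIntegral_Gavg_exp_sq_le {a : ZMod q} (ha : IsUnit a) {σ₁ : ℝ} (hσ₁ : 1 / 2 ≤ σ₁)
    (hZ : ZerosRealPartLE q σ₁) {ε : ℝ} (hε : 0 < ε) (hσ'1 : σ₁ + ε < 1) {h : ℝ} (hh : 0 < h)
    (hh1 : h ≤ 1) {θ : ℝ} (hθ : 0 < θ) (hθ1 : θ ≤ 1) (L : ℝ) :
    IntegrableOn (fun v : ℝ ↦ (Real.exp (-((σ₁ + ε) * v)) * Gavg a h θ (Real.exp v)) ^ 2) (Icc 0 L) ∧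
    ∫ v in Icc 0 L, (Real.exp (-((σ₁ + ε) * v)) * Gavg a h θ (Real.exp v)) ^ 2 ≤
      Real.exp (1 / 4) / (2 * π) * B₂ q ε θ := by
  set σ' : ℝ := σ₁ + ε with hσ'
  set g : ℝ → ℂ := gsfun a σ' h θ with hgdef
  have hg : Integrable g := integrable_gsfun hσ₁ hZ a hε le_rfl hσ'1.le hh hθ hθ1
  obtain ⟨hg2, hg2le⟩ := integral_norm_sq_gsfun_le (a := a) hσ₁ hZ hε hσ'1 hh hh1 hθ hθ1
  set b : ℝ := 1 / (1 + L ^ 2) with hb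
  have hb0 : 0 < b := by positivity
  set c : ℝ := L / 2 with hc
  have hGMV := integral_gaussian_mul_norm_sq_phi_le hg hg2 hb0 c
  have hWint := integrable_gaussian_mul_norm_sq_phi hg hb0 c
  have heq : ∀ v ∈ Icc 0 L, (Real.exp (-(σ' * v)) * Gavg a h θ (Real.exp v)) ^ 2 =
      (1 / (2 * π)) ^ 2 * ‖phi g v‖ ^ 2 := by
    intro v hv
    have h1 := Gavg_exp_eq_phi ha hσ₁ hZ hε le_rfl (by linarith) hh hθ.le hv.1
    have h2 : |Real.exp (-(σ' * v)) * Gavg a h θ (Real.exp v)| = ‖(1 / (2 * π) : ℂ) * phi g v‖ := by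
      rw [← Real.norm_eq_abs, ← Complex.norm_real, h1]
    rw [← sq_abs, h2, norm_mul, mul_pow]
    congr 1
    rw [show (1 / (2 * π) : ℂ) = ((1 / (2 * π) : ℝ) : ℂ) by push_cast; ring, Complex.norm_real,
      Real.norm_of_nonneg (by positivity)]
  have hwin : ∀ v ∈ Icc 0 L, (1 : ℝ) ≤ Real.exp (1 / 4) * Real.exp (-b * (v - c) ^ 2) := by
    intro v hv
    rw [← Real.exp_add]
    have h1 : (v - c) ^ 2 ≤ (L / 2) ^ 2 :=
      sq_le_sq' (by rw [hc]; linarith [hv.1, hv.2]) (by rw [hc]; linarith [hv.1, hv.2])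
    have h2 : b * (v - c) ^ 2 ≤ 1 / 4 := by
      calc b * (v - c) ^ 2 ≤ b * (L / 2) ^ 2 := mul_le_mul_of_nonneg_left h1 hb0.le
        _ = L ^ 2 / (4 * (1 + L ^ 2)) := by rw [hb]; field_simp; ring
        _ ≤ 1 / 4 := by rw [div_le_div_iff₀ (by positivity) (by norm_num)]; nlinarith
    linarith [Real.add_one_le_exp (1 / 4 + -b * (v - c) ^ 2)]
  have hcontφ : Continuous fun v : ℝ ↦ (1 / (2 * π)) ^ 2 * ‖phi g v‖ ^ 2 :=
    continuous_const.mul ((continuous_phi hg).norm.pow 2)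
  have hIon : IntegrableOn (fun v : ℝ ↦ (Real.exp (-(σ' * v)) * Gavg a h θ (Real.exp v)) ^ 2) (Icc 0 L) :=
    (hcontφ.integrableOn_Icc).congr_fun (fun v hv ↦ (heq v hv).symm) measurableSet_Icc
  refine ⟨hIon, ?_⟩
  set Wφ : ℝ → ℝ := fun v ↦ Real.exp (-b * (v - c) ^ 2) * ‖phi g v‖ ^ 2 with hWφ
  calc ∫ v in Icc 0 L, (Real.exp (-(σ' * v)) * Gavg a h θ (Real.exp v)) ^ 2
      = ∫ v in Icc 0 L, (1 / (2 * π)) ^ 2 * ‖phi g v‖ ^ 2 := setIntegral_congr_fun measurableSet_Icc heq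
    _ ≤ ∫ v in Icc 0 L, Real.exp (1 / 4) * (1 / (2 * π)) ^ 2 * Wφ v := by
        refine setIntegral_mono_on hcontφ.integrableOn_Icc ((hWint.const_mul _).integrableOn)
          measurableSet_Icc fun v hv ↦ ?_
        have h0 : 0 ≤ (1 / (2 * π)) ^ 2 * ‖phi g v‖ ^ 2 := by positivity
        calc (1 / (2 * π)) ^ 2 * ‖phi g v‖ ^ 2 = 1 * ((1 / (2 * π)) ^ 2 * ‖phi g v‖ ^ 2) := (one_mul _).symm
          _ ≤ (Real.exp (1 / 4) * Real.exp (-b * (v - c) ^ 2)) * ((1 / (2 * π)) ^ 2 * ‖phi g v‖ ^ 2) :=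
              mul_le_mul_of_nonneg_right (hwin v hv) h0
          _ = Real.exp (1 / 4) * (1 / (2 * π)) ^ 2 * Wφ v := by rw [hWφ]; ring
    _ ≤ ∫ v, Real.exp (1 / 4) * (1 / (2 * π)) ^ 2 * Wφ v :=
        setIntegral_le_integral (hWint.const_mul _) (ae_of_all _ fun v ↦ by positivity)
    _ = Real.exp (1 / 4) * (1 / (2 * π)) ^ 2 * ∫ v, Wφ v := MeasureTheory.integral_const_mul _ _
    _ ≤ Real.exp (1 / 4) * (1 / (2 * π)) ^ 2 * ((2 * π) * ∫ t, ‖g t‖ ^ 2) := by gcongr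
    _ ≤ Real.exp (1 / 4) * (1 / (2 * π)) ^ 2 * ((2 * π) * B₂ q ε θ) := by gcongr
    _ = Real.exp (1 / 4) / (2 * π) * B₂ q ε θ := by field_simp

/-- **Mean square of `G^{(h)}_θ` against `u^{-(2σ'+1)} du` on `[1, X]`**: `≤ e^{1/4} B₂(θ)/(2π)`.
[folklore] -/
theorem setIntegral_Gavg_sq_rpow_le {a : ZMod q} (ha : IsUnit a) {σ₁ : ℝ} (hσ₁ : 1 / 2 ≤ σ₁)
    (hZ : ZerosRealPartLE q σ₁) {ε : ℝ} (hε : 0 < ε) (hσ'1 : σ₁ + ε < 1) {h : ℝ} (hh : 0 < h)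
    (hh1 : h ≤ 1) {θ : ℝ} (hθ : 0 < θ) (hθ1 : θ ≤ 1) {X : ℝ} (hX : 1 ≤ X) :
    ∫ u in Icc 1 X, Gavg a h θ u ^ 2 * u ^ (-(2 * (σ₁ + ε) + 1)) ≤
      Real.exp (1 / 4) / (2 * π) * B₂ q ε θ := by
  set σ' : ℝ := σ₁ + ε with hσ'
  set L : ℝ := Real.log X with hLdef
  have hXL : Real.exp L = X := Real.exp_log (by linarith)
  rw [← hXL, setIntegral_Icc_one_exp _ L]
  have heq : ∀ v ∈ Icc 0 L, Real.exp v * (Gavg a h θ (Real.exp v) ^ 2 * Real.exp v ^ (-(2 * σ' + 1))) =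
      (Real.exp (-(σ' * v)) * Gavg a h θ (Real.exp v)) ^ 2 := by
    intro v _
    have h1 : Real.exp v * Real.exp v ^ (-(2 * σ' + 1)) = Real.exp (-(σ' * v)) ^ 2 := by
      rw [← Real.exp_mul, ← Real.exp_add, pow_two, ← Real.exp_add]
      congr 1; ring
    calc Real.exp v * (Gavg a h θ (Real.exp v) ^ 2 * Real.exp v ^ (-(2 * σ' + 1)))
        = Gavg a h θ (Real.exp v) ^ 2 * (Real.exp v * Real.exp v ^ (-(2 * σ' + 1))) := by ring
      _ = _ := by rw [h1]; ring
  rw [setIntegral_congr_fun measurableSet_Icc heq]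
  exact (setIntegral_Gavg_exp_sq_le ha hσ₁ hZ hε hσ'1 hh hh1 hθ hθ1 L).2

omit [NeZero q] in
/-- Linear substitution: for `f ≥ 0` integrable on `[1, Y]`, `c ≥ 1` and `Xc ≤ Y`,
`∫_{[1,X]} f(uc) du ≤ ∫_{[1,Y]} f(u) du`. [folklore] -/
theorem setIntegral_comp_mul_le {f : ℝ → ℝ} {X Y c : ℝ} (hX : 1 ≤ X) (hc : 1 ≤ c) (hY : X * c ≤ Y)
    (hf0 : ∀ u ∈ Icc 1 Y, 0 ≤ f u) (hfI : IntegrableOn f (Icc 1 Y)) :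
    ∫ u in Icc 1 X, f (u * c) ≤ ∫ u in Icc 1 Y, f u := by
  have hc0 : 0 < c := by linarith
  have himg : (fun u ↦ u * c) '' Icc 1 X = Icc (1 * c) (X * c) := Set.image_mul_right_Icc (by linarith) hc0.le
  have hsub : Icc (1 * c) (X * c) ⊆ Icc 1 Y := Icc_subset_Icc (by linarith) hY
  have h1 : ∫ u in Icc (1 * c) (X * c), f u = ∫ u in Icc 1 X, |c| • f (u * c) := by
    rw [← himg]
    exact integral_image_eq_integral_abs_deriv_smul measurableSet_Icc
      (fun x _ ↦ ((hasDerivAt_id x).mul_const c |>.congr_deriv (by simp)).hasDerivWithinAt)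
      (fun x _ y _ hxy ↦ mul_right_cancel₀ hc0.ne' hxy) f
  have h2 : ∫ u in Icc 1 X, |c| • f (u * c) = c * ∫ u in Icc 1 X, f (u * c) := by
    rw [abs_of_pos hc0]; simp only [smul_eq_mul]; exact MeasureTheory.integral_const_mul _ _
  have h3 : ∫ u in Icc (1 * c) (X * c), f u ≤ ∫ u in Icc 1 Y, f u :=
    setIntegral_mono_set hfI ((ae_restrict_iff' measurableSet_Icc).2 (ae_of_all _ hf0))
      (Eventually.of_forall hsub)
  have h4 : 0 ≤ ∫ u in Icc 1 X, f (u * c) := by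
    refine setIntegral_nonneg measurableSet_Icc fun u hu ↦ hf0 _ ⟨?_, ?_⟩
    · nlinarith [hu.1]
    · nlinarith [hu.2]
  calc ∫ u in Icc 1 X, f (u * c) ≤ c * ∫ u in Icc 1 X, f (u * c) := le_mul_of_one_le_left h4 hc
    _ = ∫ u in Icc (1 * c) (X * c), f u := by rw [h1, h2]
    _ ≤ _ := h3

/-- The absolute constant of `setIntegral_Rrem_mulShift_sq_le`. [folklore] -/
def CE2 : ℝ := 3 * (Real.exp (1 / 4) / (2 * π)) * (1296 * Cpkg ^ 2 * (2 * π + 1) * 1000000) + 132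

set_option maxHeartbeats 1600000 in
/-- **Mean square of the multiplicative difference.** For `(a, q) = 1`, under `ZerosRealPartLE q σ₁`
(`σ₁ ≥ 1/2`), `0 < ε`, `σ₁ + ε < 1`, `0 < θ ≤ 1` and `X ≥ 1`:
`∫_1^X (R(ue^θ) − R(u))² u^{-(2σ'+1)} du ≤
  C_{E2} φ(q)² ((log q + 1)² θ (1 + log(1/θ + 1))²/ε + 1/X)`, `σ' = σ₁ + ε`.
[cite: MontgomeryVaughan2007, §13.1 (method)] -/
theorem setIntegral_Rrem_mulShift_sq_le {a : ZMod q} (ha : IsUnit a) {σ₁ : ℝ} (hσ₁ : 1 / 2 ≤ σ₁)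
    (hZ : ZerosRealPartLE q σ₁) {ε : ℝ} (hε : 0 < ε) (hσ'1 : σ₁ + ε < 1) {θ : ℝ} (hθ : 0 < θ)
    (hθ1 : θ ≤ 1) {X : ℝ} (hX : 1 ≤ X) :
    IntegrableOn (fun u ↦ (Rrem a (u * Real.exp θ) - Rrem a u) ^ 2 * u ^ (-(2 * (σ₁ + ε) + 1))) (Icc 1 X) ∧
    ∫ u in Icc 1 X, (Rrem a (u * Real.exp θ) - Rrem a u) ^ 2 * u ^ (-(2 * (σ₁ + ε) + 1)) ≤
      CE2 * (q.totient : ℝ) ^ 2 *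
        ((Real.log q + 1) ^ 2 * θ * (1 + Real.log (1 / θ + 1)) ^ 2 / ε + 1 / X) := by
  set σ' : ℝ := σ₁ + ε with hσ'
  have hσ'0 : 0 ≤ σ' := by rw [hσ']; linarith
  have hX0 : 0 < X := by linarith
  have hφ1 : (1 : ℝ) ≤ q.totient := by exact_mod_cast Nat.totient_pos.2 (NeZero.pos q)
  set Y : ℝ := 3 * X with hYdef
  have hY1 : 1 ≤ Y := by rw [hYdef]; linarith
  have hY0 : 0 < Y := by linarith
  have hXY : X ≤ Y := by rw [hYdef]; linarith
  set h : ℝ := hY Y with hhdef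
  obtain ⟨hhle, hY4le⟩ := hY_le hY1
  have hh0 : 0 < h := hY_pos hY0
  have hh1 : h ≤ 1 := hhle.trans hY4le
  set c : ℝ := Real.exp θ with hcdef
  have hc1 : 1 ≤ c := by rw [hcdef]; linarith [Real.add_one_le_exp θ]
  have hc3 : c ≤ 3 := by
    rw [hcdef]
    calc Real.exp θ ≤ Real.exp 1 := Real.exp_le_exp.2 hθ1
      _ ≤ 3 := by linarith [Real.exp_one_lt_d9]
  have hXc : X * c ≤ Y := by rw [hYdef]; nlinarith
  set w : ℝ → ℝ := fun u ↦ u ^ (-(2 * σ' + 1)) with hw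
  have hwm : Measurable w := Measurable.pow_const measurable_id _
  set P : ℝ := ClassicalPsiData.psi (Lam a) (2 * Y) with hP
  have hP0 : 0 ≤ P := ClassicalPsiData.psi_nonneg (Lam_nonneg a) _
  -- crude bounds on `[1, Y]`
  have hbR : ∀ u ∈ Icc 1 Y, |Rrem a u| ≤ P + Y := by
    intro u hu
    refine (abs_Rrem_le a hu.1 hu.2).trans ?_
    have := ClassicalPsiData.psi_mono (Lam_nonneg a) (show Y ≤ 2 * Y by linarith)
    linarith
  have hbJ : ∀ u ∈ Icc 1 Y, 0 ≤ junk a Y u ∧ junk a Y u ≤ P + 1 := by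
    intro u hu
    have hu0 : 0 ≤ u := by linarith [hu.1]
    have h1 : u ≤ u * Real.exp h := by nlinarith [Real.add_one_le_exp h]
    have heh2 : Real.exp h ≤ 2 := by rw [hhdef, exp_hY hY0]; linarith
    have h2 : u * Real.exp h ≤ 2 * Y := by nlinarith [hu.2]
    have m1 := ClassicalPsiData.psi_mono (Lam_nonneg a) h1
    have m2 := ClassicalPsiData.psi_mono (Lam_nonneg a) h2
    have m3 := ClassicalPsiData.psi_nonneg (Lam_nonneg a) u
    have h3 : 0 ≤ u * (Real.exp h - 1) := mul_nonneg hu0 (by linarith [Real.add_one_le_exp h])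
    have h4 : u * (Real.exp h - 1) ≤ 1 := by
      rw [hhdef, exp_hY hY0]
      calc u * (1 + (Y ^ 4)⁻¹ - 1) = u * (Y ^ 4)⁻¹ := by ring
        _ ≤ Y * (Y ^ 4)⁻¹ := by gcongr; exact hu.2
        _ = (Y ^ 3)⁻¹ := by field_simp
        _ ≤ 1 := by rw [inv_le_comm₀ (by positivity) one_pos, inv_one]; exact one_le_pow₀ hY1
    simp only [junk, ← hhdef]
    constructor <;> linarith
  have hbA : ∀ u ∈ Icc 1 Y, |Ravg a h u| ≤ 2 * P + Y + 1 := by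
    intro u hu
    have h1 := abs_Ravg_sub_Rrem_le_junk a hY0 hu.1
    rw [← hhdef] at h1
    have h2 := hbR u hu
    obtain ⟨-, h3⟩ := hbJ u hu
    have := abs_sub_abs_le_abs_sub (Ravg a h u) (Rrem a u)
    linarith
  have hmemc : ∀ u ∈ Icc 1 X, u * c ∈ Icc 1 Y := fun u hu ↦
    ⟨by nlinarith [hu.1], by nlinarith [hu.2]⟩
  have hmemX : ∀ u ∈ Icc 1 X, u ∈ Icc 1 Y := fun u hu ↦ ⟨hu.1, hu.2.trans hXY⟩
  -- integrability of the pieces on `[1, X]`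
  have hIL : IntegrableOn (fun u ↦ (Rrem a (u * c) - Rrem a u) ^ 2 * w u) (Icc 1 X) := by
    refine integrableOn_Icc_of_bound
      (((((measurable_Rrem a).comp (measurable_id.mul_const c)).sub (measurable_Rrem a)).pow_const 2).mul hwm)
      (M := (2 * (P + Y)) ^ 2) fun u hu ↦ ?_
    obtain ⟨hw0, hw1⟩ := rpow_weight_mem hσ'0 hu.1
    show |(Rrem a (u * c) - Rrem a u) ^ 2 * w u| ≤ (2 * (P + Y)) ^ 2
    rw [abs_of_nonneg (mul_nonneg (sq_nonneg _) hw0)]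
    have h1 := hbR _ (hmemc u hu)
    have h2 := hbR _ (hmemX u hu)
    have h3 : |Rrem a (u * c) - Rrem a u| ≤ 2 * (P + Y) := by
      have := abs_sub (Rrem a (u * c)) (Rrem a u); linarith
    have := (sq_abs (Rrem a (u * c) - Rrem a u)).symm.le.trans (pow_le_pow_left₀ (abs_nonneg _) h3 2)
    nlinarith [sq_nonneg (Rrem a (u * c) - Rrem a u)]
  have hIG : IntegrableOn (fun u ↦ Gavg a h θ u ^ 2 * w u) (Icc 1 X) := by
    refine integrableOn_Icc_of_bound (((measurable_Gavg a h θ).pow_const 2).mul hwm)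
      (M := (2 * (2 * P + Y + 1)) ^ 2) fun u hu ↦ ?_
    obtain ⟨hw0, hw1⟩ := rpow_weight_mem hσ'0 hu.1
    show |Gavg a h θ u ^ 2 * w u| ≤ (2 * (2 * P + Y + 1)) ^ 2
    rw [abs_of_nonneg (mul_nonneg (sq_nonneg _) hw0)]
    have h1 := hbA _ (hmemc u hu)
    have h2 := hbA _ (hmemX u hu)
    have h3 : |Gavg a h θ u| ≤ 2 * (2 * P + Y + 1) := by
      rw [Gavg, ← hcdef]
      have := abs_sub (Ravg a h (u * c)) (Ravg a h u); linarith
    have := (sq_abs (Gavg a h θ u)).symm.le.trans (pow_le_pow_left₀ (abs_nonneg _) h3 2)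
    nlinarith [sq_nonneg (Gavg a h θ u)]
  obtain ⟨hIJ, hJle⟩ := setIntegral_junk_sq_le a hY1
  have hJm : Measurable fun u ↦ junk a Y u ^ 2 :=
    ((((measurable_psi a).comp (measurable_id.mul_const _)).sub (measurable_psi a)).add
      (measurable_id.mul_const _)).pow_const 2
  have hIJc : IntegrableOn (fun u ↦ junk a Y (u * c) ^ 2) (Icc 1 X) := by
    refine integrableOn_Icc_of_bound (hJm.comp (measurable_id.mul_const c)) (M := (P + 1) ^ 2) fun u hu ↦ ?_
    obtain ⟨h0, h1⟩ := hbJ _ (hmemc u hu)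
    show |junk a Y (u * c) ^ 2| ≤ (P + 1) ^ 2
    rw [abs_of_nonneg (sq_nonneg _)]
    exact pow_le_pow_left₀ h0 h1 2
  have hIJX : IntegrableOn (fun u ↦ junk a Y u ^ 2) (Icc 1 X) := hIJ.mono_set (Icc_subset_Icc le_rfl hXY)
  refine ⟨hIL, ?_⟩
  -- pointwise: `D² w ≤ 3 (G² w + J(uc)² + J(u)²)`
  have hpt : ∀ u ∈ Icc 1 X, (Rrem a (u * c) - Rrem a u) ^ 2 * w u ≤
      3 * (Gavg a h θ u ^ 2 * w u) + 3 * junk a Y (u * c) ^ 2 + 3 * junk a Y u ^ 2 := by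
    intro u hu
    obtain ⟨hw0, hw1⟩ := rpow_weight_mem hσ'0 hu.1
    have j1 := abs_Ravg_sub_Rrem_le_junk a hY0 (hmemc u hu).1
    have j2 := abs_Ravg_sub_Rrem_le_junk a hY0 hu.1
    rw [← hhdef] at j1 j2
    set A := Ravg a h (u * c) - Rrem a (u * c)
    set B := Ravg a h u - Rrem a u
    have hD : Rrem a (u * c) - Rrem a u = Gavg a h θ u - A + B := by
      simp only [Gavg, A, B, ← hcdef]; ring
    have hsq : (Rrem a (u * c) - Rrem a u) ^ 2 ≤ 3 * Gavg a h θ u ^ 2 + 3 * A ^ 2 + 3 * B ^ 2 := by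
      rw [hD]
      nlinarith [sq_nonneg (Gavg a h θ u + A), sq_nonneg (Gavg a h θ u - B), sq_nonneg (A + B)]
    have hA2 : A ^ 2 ≤ junk a Y (u * c) ^ 2 := by
      have := sq_abs A; have h3 := pow_le_pow_left₀ (abs_nonneg _) j1 2; linarith
    have hB2 : B ^ 2 ≤ junk a Y u ^ 2 := by
      have := sq_abs B; have h3 := pow_le_pow_left₀ (abs_nonneg _) j2 2; linarith
    calc (Rrem a (u * c) - Rrem a u) ^ 2 * w u
        ≤ (3 * Gavg a h θ u ^ 2 + 3 * A ^ 2 + 3 * B ^ 2) * w u := mul_le_mul_of_nonneg_right hsq hw0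
      _ = 3 * (Gavg a h θ u ^ 2 * w u) + (3 * A ^ 2 + 3 * B ^ 2) * w u := by ring
      _ ≤ 3 * (Gavg a h θ u ^ 2 * w u) + (3 * A ^ 2 + 3 * B ^ 2) * 1 := by gcongr
      _ ≤ 3 * (Gavg a h θ u ^ 2 * w u) + 3 * junk a Y (u * c) ^ 2 + 3 * junk a Y u ^ 2 := by linarith
  have hmain : ∫ u in Icc 1 X, Gavg a h θ u ^ 2 * w u ≤ Real.exp (1 / 4) / (2 * π) * B₂ q ε θ :=
    setIntegral_Gavg_sq_rpow_le ha hσ₁ hZ hε hσ'1 hh0 hh1 hθ hθ1 hX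
  have hJ1 : ∫ u in Icc 1 X, junk a Y (u * c) ^ 2 ≤ 66 * (q.totient : ℝ) ^ 2 / Y :=
    (setIntegral_comp_mul_le (f := fun u ↦ junk a Y u ^ 2) hX hc1 hXc (fun u _ ↦ sq_nonneg _) hIJ).trans hJle
  have hJ2 : ∫ u in Icc 1 X, junk a Y u ^ 2 ≤ 66 * (q.totient : ℝ) ^ 2 / Y :=
    (setIntegral_mono_set hIJ ((ae_restrict_iff' measurableSet_Icc).2 (ae_of_all _ fun u _ ↦ sq_nonneg _))
      (Eventually.of_forall (Icc_subset_Icc le_rfl hXY))).trans hJle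
  have hI12 : IntegrableOn (fun u ↦ 3 * (Gavg a h θ u ^ 2 * w u) + 3 * junk a Y (u * c) ^ 2) (Icc 1 X) :=
    (hIG.const_mul 3).add (hIJc.const_mul 3)
  have hIR : IntegrableOn (fun u ↦ 3 * (Gavg a h θ u ^ 2 * w u) + 3 * junk a Y (u * c) ^ 2 + 3 * junk a Y u ^ 2)
      (Icc 1 X) := hI12.add (hIJX.const_mul 3)
  set K : ℝ := 3 * (Real.exp (1 / 4) / (2 * π)) * (1296 * Cpkg ^ 2 * (2 * π + 1) * 1000000) with hKdef
  set T : ℝ := (Real.log q + 1) ^ 2 * θ * (1 + Real.log (1 / θ + 1)) ^ 2 / ε with hTdef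
  have hK0 : 0 ≤ K := by positivity
  have hK1 : K ≤ CE2 := by rw [CE2, hKdef]; linarith
  have hK2 : (132 : ℝ) ≤ CE2 := by
    rw [CE2]
    have : 0 ≤ 3 * (Real.exp (1 / 4) / (2 * π)) * (1296 * Cpkg ^ 2 * (2 * π + 1) * 1000000) := by positivity
    linarith
  have hT0 : 0 ≤ T := by positivity
  have hB₂ : 3 * (Real.exp (1 / 4) / (2 * π) * B₂ q ε θ) = K * (q.totient : ℝ) ^ 2 * T := by
    simp only [B₂, hKdef, hTdef]; ring
  have hJJ : 3 * (66 * (q.totient : ℝ) ^ 2 / Y) + 3 * (66 * (q.totient : ℝ) ^ 2 / Y) =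
      132 * (q.totient : ℝ) ^ 2 * (1 / X) := by
    rw [hYdef]; field_simp; ring
  calc ∫ u in Icc 1 X, (Rrem a (u * c) - Rrem a u) ^ 2 * w u
      ≤ ∫ u in Icc 1 X, (3 * (Gavg a h θ u ^ 2 * w u) + 3 * junk a Y (u * c) ^ 2 + 3 * junk a Y u ^ 2) :=
        setIntegral_mono_on hIL hIR measurableSet_Icc hpt
    _ = 3 * (∫ u in Icc 1 X, Gavg a h θ u ^ 2 * w u) + 3 * (∫ u in Icc 1 X, junk a Y (u * c) ^ 2) +
          3 * ∫ u in Icc 1 X, junk a Y u ^ 2 := by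
        rw [integral_add hI12 (hIJX.const_mul 3), integral_add (hIG.const_mul 3) (hIJc.const_mul 3),
          MeasureTheory.integral_const_mul, MeasureTheory.integral_const_mul, MeasureTheory.integral_const_mul]
    _ ≤ 3 * (Real.exp (1 / 4) / (2 * π) * B₂ q ε θ) + 3 * (66 * (q.totient : ℝ) ^ 2 / Y) +
          3 * (66 * (q.totient : ℝ) ^ 2 / Y) := by
        have h3 : (0 : ℝ) ≤ 3 := by norm_num
        exact add_le_add (add_le_add (mul_le_mul_of_nonneg_left hmain h3) (mul_le_mul_of_nonneg_left hJ1 h3))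
          (mul_le_mul_of_nonneg_left hJ2 h3)
    _ = K * (q.totient : ℝ) ^ 2 * T + 132 * (q.totient : ℝ) ^ 2 * (1 / X) := by rw [add_assoc, hJJ, hB₂]
    _ ≤ CE2 * (q.totient : ℝ) ^ 2 * T + CE2 * (q.totient : ℝ) ^ 2 * (1 / X) := by
        have hφ2 : 0 ≤ (q.totient : ℝ) ^ 2 := sq_nonneg _
        exact add_le_add (mul_le_mul_of_nonneg_right (mul_le_mul_of_nonneg_right hK1 hφ2) hT0)
          (mul_le_mul_of_nonneg_right (mul_le_mul_of_nonneg_right hK2 hφ2) (by positivity))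
    _ = _ := by rw [hTdef]; ring

end Literature.NumberTheory.LFunctions.ResidueRiesz

end
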